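import Literature.Algebra.EuclideanLattices.DualGridSolverProgram
import Literature.Computability.Cryptography.SamplerCoinLaws
import Literature.Computability.Cryptography.CoinBlockLaws
import Literature.Probability.Distributions.PseudoGaussianSamplerStdDiscreteGaussian
import Literature.Algebra.EuclideanLattices.MRIncGDDSolver
import HarnessLib

/-!
# The `IncGDD` solver of MR07 Thm. 5.9 on integer lattices: success of the idealised attempt, and the law of the solver's output

Topic `Algebra/EuclideanLattices` (family `pqc`). Analysis file of the solver `solRun` of
`DualGridSolverProgram.lean` (one attempt of Micciancio–Regev 2007, Thm. 5.9 for a guess `(j, α)` on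
the scaled lattice `Λ' = c_U · L(U)` through `B_U = invMatrix Uᵀ`, answers converted to coefficient
rows of `U`), in two parts.

**Part I — the idealised attempt at the good guess.** For a well-formed instance
`J = (n, U, V, tw, td, rn, rd)` of the wire format of `MRLemma510Function.lean` satisfying the promise
`3β√n · η_{2⁻ⁿ}(L(U)) < r`, and the GOOD guess `(j, α)` (`∑ zᵢtᵢ = -t`), the idealised attempt (exact
discrete Gaussians on the integer fine grid `(1/N)ℤⁿ`, `N = N₀ · td · |α| · rd`, width `s = 2^e√π/N`
from `eOfJ`) produces a member of `J.goodAnswers` with probability at least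
`(δ_{j,α} − m·(2ε/(1+ε) + n·dT/2^ℓ + n·q/N))/3` (`toReal_naturalAttempt_goodAnswers_ge`), by
instantiating `DualGridAttemptSuccess.toReal_naturalAttempt_success_ge`:

* numerics of the width: `one_le_XOfJ`, `sJ_le` (`s ≤ 2r'/(β√n)`), `le_sJ` (`9r'/(10β√n) ≤ s`),
  for `N₀ ≥ 3β√n` (`r' = c_U rn/rd` the scaled radius);
* the data of a well-formed instance read as matrices (`Um`, `Vm`, `twv`), `rowsOf_Um`,
  `scaledRows_mem` (`c V ⊂ Λ'`), `scaledRows_linearIndependent`, `norm_scaledRows_le`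
  (`‖c vⱼ‖ ≤ c ‖S‖`), `smoothingParameter_dualLat_Um` (`η(Λ') = c η(L(U))`);
* the shifts `TshJ` and target `tgtJ = c t` with `sum_smul_fineGridVec_TshJ` (`∑ zᵢ tᵢ = −c t` at the
  good guess, thanks to `td·|α|·rd ∣ N`);
* `mem_goodAnswers_of_close` — an answer `u' ∈ Λ'` with `‖u' − c t‖ ≤ c(‖S‖/8 + r)` converts
  (`answerOf`, `cast_answerOf_vecMul`) into a good answer.

**Part II — the law of the output on uniform coins.** On uniform coins the output of `solRun`
dominates, up to the explicit losses of the two guesses (the guess `(j, α)` of Thm. 5.9's step 1, and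
the guess of the oracle's coin count), the natural attempt of `DualGridAttemptSuccess.lean` driven by
the machine's pseudo-Gaussian sampler and the oracle kernel of the `SIS` algorithm `B`; the sampler is
close to the exact discrete Gaussian (`PseudoGaussianSamplerStdDiscreteGaussian.lean`), and the exact
attempt succeeds by Part I. Main result **`toReal_solRun_goodAnswers_ge`**: for a well-formed instance
with the promise `3β√n·η_{2⁻ⁿ}(L(U)) < r`,
`Pr_w[solRun … w ∈ goodAnswers] ≥ ρ_g ρ ((δ/(2βm) − m(2ε/(1+ε) + n dT/2^ℓ + n q/N₀))/3 − m n·20·2^{-mₚ})`,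
`δ = SIS.successProb B n m q β`, `ρ_g = ⌊2^{Lg}/(2β̂m)⌋/2^{Lg}`, `ρ = ⌊2^{lenBits}/(c_max+1)⌋/2^{lenBits}`.

* tools: `indepLaw_map_curry` (currying `⨂_{t<m·n} D` along `finProdFinEquiv (i,l) = l + n i`),
  `tvDist_naturalAttemptWith_le` (`Δ ≤ m·(n·Δ(D,D'))`);
* the random inputs read off coin blocks: `XfOf`, `κfOf`, `Xs_eq_ofFn`, `κs_eq_ofFn`,
  `uniformVector_map_XfOf` (`= ⨂ᵢ ⨂ₗ ℓ'`), `uniformVector_map_κfOf` (`= ⨂ᵢ boxLaw`);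
* the fixed-guess solver: `qsOf`, `ansOf`, `perGuess`, `solRun_eq_perGuess`, `perGuess_append`,
  `Gfun`/`qfun`, and on a well-formed instance `qfun_eq` (`= SIS.encodeMatrix (Amat …)`), `Gfun_eq`;
* coin plumbing: `uniformVector_map_eq_bind_split`, `uniformVector_map_take`,
  `uniformVector_map_run_take` (`= B.outputPMF`), `toReal_uniformVector_natMod_fiber_ge`,
  `uniformVector_map_pair`, `naturalAttemptWith_eq_bind`;
* the inequalities: `oracleStep_ge`, `toOuterMeasure_perGuess_ge`, `toReal_perGuess_goodAnswers_ge`,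
  `succ_le_eOfJ` (the realised sampler precision), `solRun_append_of_fiber`, **`toReal_solRun_goodAnswers_ge`**.

## References

* D. Micciancio, O. Regev, *Worst-case to average-case reductions based on Gaussian measures*,
  SIAM J. Comput. 37 (2007) 267–302; authors' version, Thm. 5.9 and its proof (pp. 22–24), Def. 5.6.
* O. Goldreich, *Foundations of Cryptography I*, CUP 2001, §3.2.3 (hybrid argument), §1.3.2
  (guessing a polynomially bounded quantity) [Goldreich2001].
* S. Aaronson, A. Arkhipov, *The computational complexity of linear optics*, Theory of Computing 9
  (2013), Thm. 1.1 (a randomised machine reads a uniform string) [AaronsonArkhipov2013].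
-/

noncomputable section

open scoped Classical ENNReal Real

namespace Literature.Algebra.EuclideanLattices

open Module Submodule Matrix Finset GSInverse Literature.Probability.Distributions PMF MRLemma510
  Literature.Computability.Complexity Literature.Computability.Complexity.CodeFP Literature.Computability.Cryptography

namespace DualGrid

/-! ### Numerics of the width -/

section Width

variable (P : SolParams) {n : ℕ}

/-- `(2^e)² = 4^e`. [folklore] -/
theorem four_pow_eq_sq (e : ℕ) : ((2 : ℝ) ^ e) ^ 2 = (4 : ℝ) ^ e := by
  rw [← pow_mul, mul_comm, pow_mul]; norm_num

/-- The scaled width `s = 2^e √π / N`. [folklore] -/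
def sJ (P : SolParams) (n : ℕ) (c : ℤ) (rn rd N : ℕ) : ℝ := (2 : ℝ) ^ eOfJ P n c rn rd N * Real.sqrt π / N

/-- `4^e ≤ X` and `X < 4^{e+1}` for `e = ⌊log₂ X⌋/2`, `X ≥ 1`. [folklore] -/
theorem four_pow_eOfJ_le {c : ℤ} {rn rd N : ℕ} (hX : 1 ≤ XOfJ P n c rn rd N) :
    4 ^ eOfJ P n c rn rd N ≤ XOfJ P n c rn rd N ∧ XOfJ P n c rn rd N < 4 ^ (eOfJ P n c rn rd N + 1) := by
  set X := XOfJ P n c rn rd N with hXdef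
  have h1 : 2 ^ Nat.log 2 X ≤ X := Nat.pow_log_le_self 2 (by omega)
  have h2 : X < 2 ^ (Nat.log 2 X + 1) := Nat.lt_pow_succ_log_self (by norm_num) X
  rw [eOfJ, ← hXdef]
  constructor
  · calc 4 ^ (Nat.log 2 X / 2) = 2 ^ (2 * (Nat.log 2 X / 2)) := by rw [pow_mul]; norm_num
      _ ≤ 2 ^ Nat.log 2 X := Nat.pow_le_pow_right (by norm_num) (Nat.mul_div_le _ _)
      _ ≤ X := h1
  · calc X < 2 ^ (Nat.log 2 X + 1) := h2
      _ ≤ 2 ^ (2 * (Nat.log 2 X / 2 + 1)) := Nat.pow_le_pow_right (by norm_num) (by omega)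
      _ = 4 ^ (Nat.log 2 X / 2 + 1) := by rw [pow_mul]; norm_num

variable {P}

/-- The real quotient behind `X`. [folklore] -/
theorem XOfJ_le_real (hnum : 0 < P.βnum) (hn : 0 < n) {c : ℤ} {rn rd N : ℕ} (hrd : 0 < rd) :
    (XOfJ P n c rn rd N : ℝ) ≤ 80 * (c : ℝ) ^ 2 * rn ^ 2 * N ^ 2 * P.βden ^ 2 / (63 * P.βnum ^ 2 * n * rd ^ 2) ∧
      80 * (c : ℝ) ^ 2 * rn ^ 2 * N ^ 2 * P.βden ^ 2 / (63 * P.βnum ^ 2 * n * rd ^ 2) < XOfJ P n c rn rd N + 1 := by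
  have hc : ((c.natAbs : ℕ) : ℝ) ^ 2 = (c : ℝ) ^ 2 := by rw [Nat.cast_natAbs, Int.cast_abs, sq_abs]
  have hden : (0 : ℝ) < 63 * P.βnum ^ 2 * n * rd ^ 2 := by positivity
  constructor
  · rw [XOfJ]
    refine (Nat.cast_div_le).trans (le_of_eq ?_)
    push_cast; rw [hc]
  · rw [XOfJ, div_lt_iff₀ hden]
    have h := Nat.lt_div_mul_add (a := 80 * c.natAbs ^ 2 * rn ^ 2 * N ^ 2 * P.βden ^ 2) (b := 63 * P.βnum ^ 2 * n * rd ^ 2) (by positivity)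
    have h' : ((80 * c.natAbs ^ 2 * rn ^ 2 * N ^ 2 * P.βden ^ 2 : ℕ) : ℝ) <
        ((80 * c.natAbs ^ 2 * rn ^ 2 * N ^ 2 * P.βden ^ 2 / (63 * P.βnum ^ 2 * n * rd ^ 2) * (63 * P.βnum ^ 2 * n * rd ^ 2) +
          63 * P.βnum ^ 2 * n * rd ^ 2 : ℕ) : ℝ) := by exact_mod_cast h
    push_cast at h'
    rw [hc] at h'
    linarith

/-- **`X ≥ 1`** once `N ≥ β√n · rd` and `c rn ≥ 1`. [folklore] -/
theorem one_le_XOfJ (hnum : 0 < P.βnum) (hden : 0 < P.βden) (hn : 0 < n) {c : ℤ} (hc : 1 ≤ c) {rn rd N : ℕ} (hrn : 1 ≤ rn) (hrd : 0 < rd)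
    (hN : ((P.βnum : ℝ) / P.βden) * Real.sqrt n * rd ≤ N) : 1 ≤ XOfJ P n c rn rd N := by
  rw [XOfJ, Nat.le_div_iff_mul_le (by positivity), one_mul]
  have hc1 : (1 : ℝ) ≤ c := by exact_mod_cast hc
  have hrn1 : (1 : ℝ) ≤ rn := by exact_mod_cast hrn
  have hsn : (0 : ℝ) < Real.sqrt n := Real.sqrt_pos.2 (by exact_mod_cast hn)
  have h1 : ((P.βnum : ℝ) / P.βden * Real.sqrt n * rd) ^ 2 ≤ (N : ℝ) ^ 2 := pow_le_pow_left₀ (by positivity) hN 2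
  rw [mul_pow, mul_pow, div_pow, Real.sq_sqrt (by positivity)] at h1
  have hd : (0 : ℝ) < P.βden ^ 2 := by positivity
  have h2 : (P.βnum : ℝ) ^ 2 * n * rd ^ 2 ≤ N ^ 2 * P.βden ^ 2 := by
    have := mul_le_mul_of_nonneg_right h1 hd.le
    rwa [show (P.βnum : ℝ) ^ 2 / P.βden ^ 2 * n * rd ^ 2 * P.βden ^ 2 = P.βnum ^ 2 * n * rd ^ 2 by field_simp] at this
  have h3 : (1 : ℝ) ≤ (c : ℝ) ^ 2 * rn ^ 2 := one_le_mul_of_one_le_of_one_le (one_le_pow₀ hc1) (one_le_pow₀ hrn1)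
  have h4 : (63 : ℝ) * P.βnum ^ 2 * n * rd ^ 2 ≤ 80 * c.natAbs ^ 2 * rn ^ 2 * N ^ 2 * P.βden ^ 2 := by
    rw [show ((c.natAbs : ℕ) : ℝ) ^ 2 = (c : ℝ) ^ 2 by rw [Nat.cast_natAbs, Int.cast_abs, sq_abs]]
    have h5 : (0 : ℝ) ≤ N ^ 2 * P.βden ^ 2 := by positivity
    nlinarith [mul_le_mul_of_nonneg_left h2 (by positivity : (0:ℝ) ≤ c ^ 2 * rn ^ 2)]
  exact_mod_cast h4

/-- **`s ≤ 2r'/(β√n)`** (`r' = c rn/rd`; from `4^e ≤ X` and `80π/63 ≤ 4`). [cite: MicciancioRegev2007, Thm. 5.9 (s = 2r/γ) — machine numerics] -/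
theorem sJ_le (hnum : 0 < P.βnum) (hden : 0 < P.βden) (hn : 0 < n) {c : ℤ} (hc : 1 ≤ c) {rn rd N : ℕ} (hrn : 1 ≤ rn) (hrd : 0 < rd)
    (hN : ((P.βnum : ℝ) / P.βden) * Real.sqrt n * rd ≤ N) :
    sJ P n c rn rd N ≤ 2 * ((c : ℝ) * rn / rd) / (((P.βnum : ℝ) / P.βden) * Real.sqrt n) := by
  have hX := one_le_XOfJ hnum hden hn hc hrn hrd hN
  have hN0 : (0 : ℝ) < N := by
    have hsn : (0 : ℝ) < Real.sqrt n := Real.sqrt_pos.2 (by exact_mod_cast hn)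
    exact lt_of_lt_of_le (by positivity) hN
  obtain ⟨h4, -⟩ := four_pow_eOfJ_le P hX
  obtain ⟨hXy, -⟩ := XOfJ_le_real hnum hn (c := c) (rn := rn) (N := N) hrd
  have h4' : (4 : ℝ) ^ eOfJ P n c rn rd N ≤ 80 * (c : ℝ) ^ 2 * rn ^ 2 * N ^ 2 * P.βden ^ 2 / (63 * P.βnum ^ 2 * n * rd ^ 2) :=
    le_trans (by exact_mod_cast h4) hXy
  rw [sJ]
  refine (pow_le_pow_iff_left₀ (by positivity) (by positivity) two_ne_zero).1 ?_
  have e1 : ((2 : ℝ) ^ eOfJ P n c rn rd N * Real.sqrt π / N) ^ 2 = (4 : ℝ) ^ eOfJ P n c rn rd N * π / N ^ 2 := by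
    rw [div_pow, mul_pow, Real.sq_sqrt Real.pi_pos.le, four_pow_eq_sq]
  have e2 : (2 * ((c : ℝ) * rn / rd) / (((P.βnum : ℝ) / P.βden) * Real.sqrt n)) ^ 2 = 4 * (c : ℝ) ^ 2 * rn ^ 2 * P.βden ^ 2 / (P.βnum ^ 2 * n * rd ^ 2) := by
    have hsn : (0 : ℝ) < Real.sqrt n := Real.sqrt_pos.2 (by exact_mod_cast hn)
    field_simp
    rw [Real.sq_sqrt (by positivity)]
    ring
  rw [e1, e2, div_le_div_iff₀ (by positivity) (by positivity)]
  have hpi := Real.pi_lt_d2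
  have hpos : (0 : ℝ) ≤ (c : ℝ) ^ 2 * rn ^ 2 * N ^ 2 * P.βden ^ 2 := by positivity
  calc (4 : ℝ) ^ eOfJ P n c rn rd N * π * (P.βnum ^ 2 * n * rd ^ 2)
      ≤ 80 * (c : ℝ) ^ 2 * rn ^ 2 * N ^ 2 * P.βden ^ 2 / (63 * P.βnum ^ 2 * n * rd ^ 2) * 3.15 * (P.βnum ^ 2 * n * rd ^ 2) := by
        gcongr
    _ = (c : ℝ) ^ 2 * rn ^ 2 * N ^ 2 * P.βden ^ 2 * (80 * 3.15 / 63) := by field_simp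
    _ ≤ 4 * (c : ℝ) ^ 2 * rn ^ 2 * P.βden ^ 2 * N ^ 2 := by nlinarith

/-- **`9r'/(10β√n) ≤ s`** (from `X < 4^{e+1}`, `⌊y⌋ > y − 1`, `3.14 < π`, `N ≥ 3β√n·rd`). [cite: MicciancioRegev2007, Thm. 5.9 — machine numerics] -/
theorem le_sJ (hnum : 0 < P.βnum) (hden : 0 < P.βden) (hn : 0 < n) {c : ℤ} (hc : 1 ≤ c) {rn rd N : ℕ} (hrn : 1 ≤ rn) (hrd : 0 < rd)
    (hN : 3 * ((P.βnum : ℝ) / P.βden) * Real.sqrt n * rd ≤ N) :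
    9 / 10 * ((c : ℝ) * rn / rd) / (((P.βnum : ℝ) / P.βden) * Real.sqrt n) ≤ sJ P n c rn rd N := by
  have hsn : (0 : ℝ) < Real.sqrt n := Real.sqrt_pos.2 (by exact_mod_cast hn)
  have hβ : (0 : ℝ) < (P.βnum : ℝ) / P.βden := by positivity
  have hN' : ((P.βnum : ℝ) / P.βden) * Real.sqrt n * rd ≤ N := le_trans (by nlinarith [mul_pos (mul_pos hβ hsn) (show (0:ℝ) < rd by exact_mod_cast hrd)]) hN
  have hX := one_le_XOfJ hnum hden hn hc hrn hrd hN'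
  have hN0 : (0 : ℝ) < N := lt_of_lt_of_le (by positivity) hN'
  obtain ⟨-, h4⟩ := four_pow_eOfJ_le P hX
  obtain ⟨-, hyX⟩ := XOfJ_le_real hnum hn (c := c) (rn := rn) (N := N) hrd
  -- `4 · 4^e ≥ X + 1 > y`
  have h4' : 80 * (c : ℝ) ^ 2 * rn ^ 2 * N ^ 2 * P.βden ^ 2 / (63 * P.βnum ^ 2 * n * rd ^ 2) < 4 * (4 : ℝ) ^ eOfJ P n c rn rd N := by
    have : ((XOfJ P n c rn rd N : ℕ) : ℝ) + 1 ≤ ((4 ^ (eOfJ P n c rn rd N + 1) : ℕ) : ℝ) := by exact_mod_cast h4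
    push_cast at this; rw [pow_succ] at this; linarith
  rw [sJ]
  refine (pow_le_pow_iff_left₀ (by positivity) (by positivity) two_ne_zero).1 ?_
  have e1 : ((2 : ℝ) ^ eOfJ P n c rn rd N * Real.sqrt π / N) ^ 2 = (4 : ℝ) ^ eOfJ P n c rn rd N * π / N ^ 2 := by
    rw [div_pow, mul_pow, Real.sq_sqrt Real.pi_pos.le, four_pow_eq_sq]
  have e2 : (9 / 10 * ((c : ℝ) * rn / rd) / (((P.βnum : ℝ) / P.βden) * Real.sqrt n)) ^ 2 =
      81 / 100 * (c : ℝ) ^ 2 * rn ^ 2 * P.βden ^ 2 / (P.βnum ^ 2 * n * rd ^ 2) := by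
    field_simp; rw [Real.sq_sqrt (by positivity)]; ring
  rw [e1, e2, div_le_div_iff₀ (by positivity) (by positivity)]
  have hpi := Real.pi_gt_d2
  rw [div_lt_iff₀ (by positivity)] at h4'
  -- `N² βnum² n rd² ≥ 9 βnum² ... `: from `hN`, `9 β² n rd² ≤ N²`
  have hN2 : 9 * (P.βnum : ℝ) ^ 2 * n * rd ^ 2 ≤ N ^ 2 * P.βden ^ 2 := by
    have h1 : (3 * ((P.βnum : ℝ) / P.βden) * Real.sqrt n * rd) ^ 2 ≤ (N : ℝ) ^ 2 := pow_le_pow_left₀ (by positivity) hN 2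
    rw [mul_pow, mul_pow, mul_pow, div_pow, Real.sq_sqrt (by positivity)] at h1
    have hd : (0 : ℝ) < P.βden ^ 2 := by positivity
    have := mul_le_mul_of_nonneg_right h1 hd.le
    rw [show (3 : ℝ) ^ 2 * ((P.βnum : ℝ) ^ 2 / P.βden ^ 2) * n * rd ^ 2 * P.βden ^ 2 = 9 * P.βnum ^ 2 * n * rd ^ 2 by field_simp; norm_num] at this
    linarith
  have hXQ : (0 : ℝ) ≤ 4 ^ eOfJ P n c rn rd N * ((P.βnum : ℝ) ^ 2 * n * rd ^ 2) := by positivity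
  have hY : (0 : ℝ) ≤ (c : ℝ) ^ 2 * rn ^ 2 * P.βden ^ 2 := by positivity
  nlinarith [mul_nonneg (sub_nonneg.2 hpi.le) hXQ, h4', mul_le_mul_of_nonneg_left hN2 hY]

end Width

/-! ### A well-formed instance read as matrices -/

section Instance

open IncGDDInst

variable (P : SolParams) (J : IncGDDInst)

/-- The rows of `U` as a matrix. [folklore] -/
def Um : Matrix (Fin J.n) (Fin J.n) ℤ := LMat.toMat J.n J.n J.U
/-- The rows of `V` as a matrix. [folklore] -/
def Vm : Matrix (Fin J.n) (Fin J.n) ℤ := LMat.toMat J.n J.n J.V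
/-- The target numerator as a vector. [folklore] -/
def twv : Fin J.n → ℤ := fun t => J.tw.getD t 0
/-- **The shifts of the attempt for the guess `(j, α)`** (grid units): `-(N₀ sign α rd) c_U · tw` at `i = j`. [cite: MicciancioRegev2007, Thm. 5.9 (step 1)] -/
def TshJ (j : ℕ) (α : ℤ) : Fin P.m → Fin J.n → ℤ :=
  fun i => if (i : ℕ) = j then (-((P.N₀ : ℤ) * α.sign * J.rd) * cU (Um J)) • twv J else 0
/-- **The scaled target `c_U t`.** [folklore] -/
def tgtJ : EuclideanSpace ℝ (Fin J.n) := (cU (Um J) : ℝ) • J.target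
/-- The grid parameter of the attempt. [folklore] -/
def NJ (α : ℤ) : ℕ := NOf P J.td J.rd α
/-- The index `dT` of the attempt. [folklore] -/
def dTJ : ℤ := dT (BU (Um J)) (scaledRows (Um J) (Vm J))
/-- The width `s` of the attempt. [folklore] -/
def sOfJ (α : ℤ) : ℝ := sJ P J.n (cU (Um J)) J.rn J.rd (NJ P J α)

variable {P J}

/-- `N ≠ 0` for a nonzero guess. [folklore] -/
theorem neZero_NJ (hJ : J.WellFormed) (hN0 : 0 < P.N₀) {α : ℤ} (hα : α ≠ 0) : NeZero (NJ P J α) :=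
  ⟨by rw [NJ, NOf]; exact Nat.mul_ne_zero (Nat.mul_ne_zero (Nat.mul_ne_zero hN0.ne' hJ.td_pos.ne') (Int.natAbs_ne_zero.2 hα)) hJ.rd_pos.ne'⟩

/-- `det U ≠ 0`. [folklore] -/
theorem det_Um (hJ : J.WellFormed) : (Um J).det ≠ 0 := hJ.det_U

/-- `rowsOf_Um` (reading a well-formed instance). [folklore] -/
theorem rowsOf_Um (hJ : J.WellFormed) : rowsOf (Um J) = J.U := rowsOf_toMat hJ.len_U hJ.row_U

/-- `rowsOf_Vm` (reading a well-formed instance). [folklore] -/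
theorem rowsOf_Vm (hJ : J.WellFormed) : rowsOf (Vm J) = J.V := rowsOf_toMat hJ.len_V hJ.row_V

/-- `vecL_twv` (reading a well-formed instance). [folklore] -/
theorem vecL_twv (hJ : J.WellFormed) : vecL (twv J) = J.tw := vecL_ofL hJ.len_tw

/-- The `i`-th row read in `ℝⁿ` is `intVecToEuclidean (Vm J i)`. [folklore] -/
theorem rowVec_eq_Vm (i : Fin J.n) : rowVec J.n J.V i = intVecToEuclidean J.n (Vm J i) := rfl

/-- `vecOf (row i) = intVecToEuclidean (Vm J i)`. [folklore] -/
theorem vecOf_getD_eq_Vm (i : Fin J.n) : vecOf J.n (J.V.getD i []) = intVecToEuclidean J.n (Vm J i) := rfl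

/-- `vecOf tw = intVecToEuclidean (twv J)`. [folklore] -/
theorem vecOf_tw : vecOf J.n J.tw = intVecToEuclidean J.n (twv J) := rfl

/-- The lattice of the instance is `L(Um)`. [folklore] -/
theorem lattice_eq : J.lattice = ((⟨J.n, Um J⟩ : LatticeInstance)).lattice := rfl

/-- **The rows of `V` are integer combinations of the rows of `U`.** [cite: MicciancioRegev2007, Def. 5.6 (S ⊂ L(B))] -/
theorem exists_Vm_eq_vecMul (hJ : J.WellFormed) (j : Fin J.n) : ∃ z : Fin J.n → ℤ, Vm J j = z ᵥ* Um J := by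
  obtain ⟨z, hz⟩ := ((⟨J.n, Um J⟩ : LatticeInstance).mem_lattice_iff _).1 (hJ.mem_V j j.2)
  exact ⟨z, (intVecToEuclidean_injective J.n hz).symm⟩

/-- **`c V ⊂ Λ'`.** [folklore] -/
theorem scaledRows_mem (hJ : J.WellFormed) (j : Fin J.n) : intVecToEuclidean J.n (scaledRows (Um J) (Vm J) j) ∈ dualLat (BU (Um J)) := by
  obtain ⟨z, hz⟩ := exists_Vm_eq_vecMul hJ j
  rw [scaledRows, hz]
  exact smul_vecMul_mem_dualLat_BU (det_Um hJ) z

/-- **`c V` is linearly independent.** [folklore] -/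
theorem scaledRows_linearIndependent (hJ : J.WellFormed) :
    LinearIndependent ℝ fun j => intVecToEuclidean J.n (scaledRows (Um J) (Vm J) j) := by
  have hc : (cU (Um J) : ℝ) ≠ 0 := by exact_mod_cast (cU_pos (det_Um hJ)).ne'
  have h := hJ.indep_V.units_smul fun _ => Units.mk0 (cU (Um J) : ℝ) hc
  convert h using 1
  funext j
  simp only [Pi.smul_apply', Units.smul_mk0, scaledRows, rowVec_eq_Vm, map_zsmul, Int.cast_smul_eq_zsmul]

/-- **`‖c vⱼ‖ ≤ c ‖S‖`.** [folklore] -/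
theorem norm_scaledRows_le (hJ : J.WellFormed) (j : Fin J.n) :
    ‖intVecToEuclidean J.n (scaledRows (Um J) (Vm J) j)‖ ≤ (cU (Um J) : ℝ) * J.maxNorm := by
  have hc : (0 : ℝ) < cU (Um J) := by exact_mod_cast cU_pos (det_Um hJ)
  rw [scaledRows, map_zsmul, ← Int.cast_smul_eq_zsmul ℝ, norm_smul, Real.norm_eq_abs, abs_of_pos hc]
  refine mul_le_mul_of_nonneg_left ?_ hc.le
  have hV : J.V ≠ [] := by
    intro h; have h1 := hJ.len_V; rw [h, List.length_nil] at h1; have := hJ.one_le_n; omega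
  obtain ⟨-, -, hle⟩ := roundIdx_spec hV
  have h1 : sqNormZ (J.V.getD j []) ≤ J.maxSqNorm := hle j (by rw [hJ.len_V]; exact j.2)
  have h2 : (sqNormZ (J.V.getD j []) : ℝ) = ‖intVecToEuclidean J.n (Vm J j)‖ ^ 2 := by
    rw [cast_sqNormZ (n := J.n) (by rw [List.getD_eq_getElem _ _ (by rw [hJ.len_V]; exact j.2)]; exact (hJ.row_V _ (List.getElem_mem _)).le)]
    rfl
  rw [IncGDDInst.maxNorm, ← Real.sqrt_sq (norm_nonneg _), ← h2]
  exact Real.sqrt_le_sqrt (by exact_mod_cast h1)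

/-- `η_ε(Λ') = c_U η_ε(L(U))`. [folklore] -/
theorem smoothingParameter_dualLat_Um (hJ : J.WellFormed) (ε : ℝ) :
    smoothingParameter (dualLat (BU (Um J))) ε = (cU (Um J) : ℝ) * smoothingParameter J.lattice ε :=
  smoothingParameter_dualLat_BU (det_Um hJ) ε

/-- **`∑ zᵢ tᵢ = −c t` at the good guess**: with `N = N₀ td |α| rd`, `z_j = α ≠ 0`.
[cite: MicciancioRegev2007, Thm. 5.9 (proof: "Tz = −t")] -/
theorem sum_smul_fineGridVec_TshJ (hJ : J.WellFormed) (hN0 : 0 < P.N₀) {j : Fin P.m} {α : ℤ} (hα : α ≠ 0) [NeZero (NJ P J α)]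
    {z : Fin P.m → ℤ} (hz : z j = α) :
    ∑ i, (z i : ℝ) • fineGridVec J.n (NJ P J α) (TshJ P J j α i) = -tgtJ J := by
  rw [Finset.sum_eq_single j]
  · rw [TshJ, if_pos rfl, hz, tgtJ, IncGDDInst.target, vecOf_tw, fineGridVec, map_zsmul, ← Int.cast_smul_eq_zsmul ℝ, smul_smul, smul_smul,
      smul_smul, ← neg_smul]
    congr 1
    have hN : ((NJ P J α : ℕ) : ℝ) = (P.N₀ : ℝ) * J.td * |(α : ℝ)| * J.rd := by
      rw [NJ, NOf]; push_cast; rw [Nat.cast_natAbs, Int.cast_abs]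
    have hsign : (α : ℝ) * (α.sign : ℝ) = |(α : ℝ)| := by
      have := Int.mul_sign_self α
      have h : ((α * α.sign : ℤ) : ℝ) = ((α.natAbs : ℤ) : ℝ) := by rw [this]
      push_cast at h
      simpa [Nat.cast_natAbs, Int.cast_abs] using h
    have hα' : (0 : ℝ) < |(α : ℝ)| := abs_pos.2 (by exact_mod_cast hα)
    have htd : (0 : ℝ) < J.td := by exact_mod_cast hJ.td_pos
    have hrd : (0 : ℝ) < J.rd := by exact_mod_cast hJ.rd_pos
    have hN0' : (0 : ℝ) < P.N₀ := by exact_mod_cast hN0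
    rw [hN]
    push_cast
    rw [← hsign]
    have hs0 : (α.sign : ℝ) ≠ 0 := by
      have : α.sign ≠ 0 := fun h => hα (Int.sign_eq_zero_iff_zero.1 h)
      exact_mod_cast this
    have hα0 : (α : ℝ) ≠ 0 := by exact_mod_cast hα
    field_simp
  · intro i _ hi
    rw [TshJ, if_neg (fun h => hi (Fin.ext h)), fineGridVec, map_zero, smul_zero, smul_zero]
  · exact fun h => (h (Finset.mem_univ j)).elim

/-! ### Good answers from close lattice vectors -/

/-- **A close vector of `Λ'` converts into a good answer**: if `u' ∈ Λ'` and
`‖u' − c t‖ ≤ c (‖S‖/8 + r)`, then the code of `answerOf U u'` lies in `J.goodAnswers`.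
[cite: MicciancioRegev2007, Def. 5.6 (IncGDD solutions) with Thm. 5.9] -/
theorem mem_goodAnswers_of_close (hJ : J.WellFormed) {u' : Fin J.n → ℤ} (hu : intVecToEuclidean J.n u' ∈ dualLat (BU (Um J)))
    (hdist : ‖intVecToEuclidean J.n u' - tgtJ J‖ ≤ (cU (Um J) : ℝ) * (J.maxNorm / 8 + J.radius)) :
    rawE intE (vecL (answerOf (Um J) u')) ∈ J.goodAnswers := by
  have hc : (0 : ℝ) < cU (Um J) := by exact_mod_cast cU_pos (det_Um hJ)
  refine ⟨by rw [readVec_rawE, length_vecL], ?_⟩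
  rw [readVec_rawE, vecOf_vecMulZ]
  have h1 : ((⟨J.n, LMat.toMat J.n J.n J.U⟩ : LatticeInstance)).ofCoeffs (fun i => (vecL (answerOf (Um J) u')).getD i 0) =
      intVecToEuclidean J.n (answerOf (Um J) u' ᵥ* Um J) := by
    simp only [getD_vecL]; rfl
  rw [h1, cast_answerOf_vecMul (det_Um hJ) hu, show J.target = ((cU (Um J) : ℝ))⁻¹ • tgtJ J by
    rw [tgtJ, smul_smul, inv_mul_cancel₀ hc.ne', one_smul], ← smul_sub, norm_smul, norm_inv, Real.norm_eq_abs, abs_of_pos hc,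
    inv_mul_le_iff₀ hc]
  exact hdist

/-! ### The success of the idealised attempt at the good guess -/

set_option maxHeartbeats 1600000 in
/-- **MR07 Thm. 5.9 for the solver (idealised, good guess).** For a well-formed instance with the
promise `3β√n · η_{2⁻ⁿ}(L(U)) < r`, a guess `(j, α)`, `α ≠ 0`, parameters `q ≤ N₀`, `3β√n ≤ N₀`,
`8 n √m β ≤ q` and the side condition of Thm. 5.9 for `ε = 2⁻ⁿ`, the idealised attempt on
`(B_U, N, c V)` with the shifts of the guess and width `s` outputs a good answer with probability at
least `(δ_{j,α} − m·(2ε/(1+ε) + n·dT/2^ℓ + n·q/N))/3`, `δ_{j,α} = Pr_{A∼U, z∼O(A)}[Az ≡ 0, ∑zᵢ² ≤ β², z_j = α]`.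
[cite: MicciancioRegev2007, Thm. 5.9 (statement p. 22, proof pp. 22–24)] -/
theorem toReal_naturalAttempt_goodAnswers_ge (hJ : J.WellFormed) [NeZero P.q] (hN0 : 0 < P.N₀)
    (O : Matrix (Fin J.n) (Fin P.m) (ZMod P.q) → PMF (Fin P.m → ℤ)) {β : ℝ} (hβeq : β = (P.βnum : ℝ) / P.βden)
    (hnum : 0 < P.βnum) (hden : 0 < P.βden) (hN03 : 3 * β * Real.sqrt J.n ≤ P.N₀) (hqN0 : P.q ≤ P.N₀)
    (hq8 : 8 * J.n * Real.sqrt P.m * β ≤ P.q)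
    (hside : 1 / (2 * π) + (2⁻¹ : ℝ) ^ J.n / (1 - (2⁻¹ : ℝ) ^ J.n) + ((2⁻¹ : ℝ) ^ J.n / (1 - (2⁻¹ : ℝ) ^ J.n)) ^ 2 * P.m ≤ 1 / 6)
    (hprom : J.Promise (3 * β * Real.sqrt J.n)) (j : Fin P.m) {α : ℤ} (hα : α ≠ 0) [NeZero (NJ P J α)] (ℓ : ℕ) :
    (1 / 3 : ℝ) *
        ((((PMF.uniformOfFintype (Matrix (Fin J.n) (Fin P.m) (ZMod P.q))).bind fun A => (O A).map (Prod.mk A)).toOuterMeasure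
            {az | az.1.mulVec (fun i => (az.2 i : ZMod P.q)) = 0 ∧ ∑ i, (az.2 i : ℝ) ^ 2 ≤ β ^ 2 ∧ az.2 j = α}).toReal -
          P.m * (2 * (2⁻¹ : ℝ) ^ J.n / (1 + (2⁻¹ : ℝ) ^ J.n) + J.n * ((((dTJ J).toNat : ℕ) : ℝ) / 2 ^ ℓ) + J.n * ((P.q : ℝ) / NJ P J α))) ≤
      ((naturalAttempt (BU (Um J)) (NJ P J α) (scaledRows (Um J) (Vm J)) O (sOfJ P J α) (TshJ P J j α) ℓ).toOuterMeasure
        {u' | rawE intE (vecL (answerOf (Um J) u')) ∈ J.goodAnswers}).toReal := by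
  -- standing data
  have hn : 1 ≤ J.n := hJ.one_le_n
  have hB := det_BU_ne_zero (det_Um hJ)
  have hS := scaledRows_mem hJ
  have hli := scaledRows_linearIndependent hJ
  haveI := neZero_MM (N := NJ P J α) hB hS hli
  haveI := neZero_Mo (N := NJ P J α) hB
  have hc : (0 : ℝ) < cU (Um J) := by exact_mod_cast cU_pos (det_Um hJ)
  have hc1 : 1 ≤ cU (Um J) := cU_pos (det_Um hJ)
  have hβ : 0 < β := by rw [hβeq]; positivity
  have hsn : (0 : ℝ) < Real.sqrt J.n := Real.sqrt_pos.2 (by exact_mod_cast hn)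
  have hη0 := smoothingParameter_nonneg J.lattice ((2⁻¹ : ℝ) ^ J.n)
  -- the radius: `rn ≥ 1`, the scaled radius `r' = c rn/rd`
  have hrad : J.radius = (J.rn : ℝ) / J.rd := rfl
  have hrn : 1 ≤ J.rn := by
    have h : (0 : ℝ) < J.radius := lt_of_le_of_lt (by positivity) hprom
    rw [hrad] at h
    have hrd : (0 : ℝ) < J.rd := by exact_mod_cast hJ.rd_pos
    have : (0 : ℝ) < J.rn := by
      by_contra h'
      push Not at h'
      have := div_nonpos_of_nonpos_of_nonneg h' hrd.le
      linarith
    exact_mod_cast this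
  -- `N ≥ N₀ rd ≥ max(q, 3β√n rd)`
  have hNge : (P.N₀ : ℝ) * J.rd ≤ NJ P J α := by
    rw [NJ, NOf]; push_cast
    have h1 : (1 : ℝ) ≤ J.td := by exact_mod_cast hJ.td_pos
    have h2 : (1 : ℝ) ≤ (α.natAbs : ℝ) := by exact_mod_cast Int.natAbs_pos.2 hα
    have h3 : (0 : ℝ) ≤ P.N₀ := by positivity
    have h4 : (0 : ℝ) ≤ J.rd := by positivity
    nlinarith [mul_le_mul (le_refl (P.N₀ : ℝ)) (one_le_mul_of_one_le_of_one_le h1 h2) zero_le_one h3]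
  have hrd1 : (1 : ℝ) ≤ J.rd := by exact_mod_cast hJ.rd_pos
  have hqN : P.q ≤ NJ P J α := by
    have : (P.q : ℝ) ≤ NJ P J α := by
      calc (P.q : ℝ) ≤ P.N₀ := by exact_mod_cast hqN0
        _ ≤ P.N₀ * J.rd := le_mul_of_one_le_right (by positivity) hrd1
        _ ≤ _ := hNge
    exact_mod_cast this
  have hN3 : 3 * ((P.βnum : ℝ) / P.βden) * Real.sqrt J.n * J.rd ≤ NJ P J α := by
    rw [← hβeq]
    calc 3 * β * Real.sqrt J.n * J.rd ≤ P.N₀ * J.rd := mul_le_mul_of_nonneg_right hN03 (by positivity)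
      _ ≤ _ := hNge
  have hN1 : ((P.βnum : ℝ) / P.βden) * Real.sqrt J.n * J.rd ≤ NJ P J α := by
    rw [← hβeq] at hN3 ⊢; nlinarith [mul_pos (mul_pos hβ hsn) (show (0:ℝ) < J.rd by positivity)]
  -- the width and `r`
  set sW := sOfJ P J α with hsW
  have hsle : sW ≤ 2 * ((cU (Um J) : ℝ) * J.rn / J.rd) / (β * Real.sqrt J.n) := by
    have := sJ_le (P := P) hnum hden (Nat.pos_of_ne_zero (by omega)) hc1 hrn hJ.rd_pos hN1; rwa [← hβeq] at this
  have hsge : 9 / 10 * ((cU (Um J) : ℝ) * J.rn / J.rd) / (β * Real.sqrt J.n) ≤ sW := by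
    have := le_sJ (P := P) hnum hden (Nat.pos_of_ne_zero (by omega)) hc1 hrn hJ.rd_pos hN3; rwa [← hβeq] at this
  set r : ℝ := sW * β * Real.sqrt J.n / 2 with hr
  have hr' : 0 < (cU (Um J) : ℝ) * J.rn / J.rd := by
    have : (1 : ℝ) ≤ J.rn := by exact_mod_cast hrn
    positivity
  have hsW0 : 0 < sW := lt_of_lt_of_le (by positivity) hsge
  have hr0 : 0 < r := by positivity
  have hs_eq : 2 * r / (β * Real.sqrt J.n) = sW := by rw [hr]; field_simp
  -- the promise gives `2η ≤ s`
  have hηs : 2 * smoothingParameter (dualLat (BU (Um J))) ((2⁻¹ : ℝ) ^ J.n) ≤ 2 * r / (β * Real.sqrt J.n) := by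
    rw [hs_eq, smoothingParameter_dualLat_Um hJ]
    have hp : 3 * β * Real.sqrt J.n * smoothingParameter J.lattice ((2⁻¹ : ℝ) ^ J.n) < (J.rn : ℝ) / J.rd := hprom
    refine le_trans ?_ hsge
    -- `2 c η < 2 c rn/(3 β √n rd) ≤ (9/10) c rn/(rd β √n)`
    rw [le_div_iff₀ (by positivity)]
    have h1 : (cU (Um J) : ℝ) * (3 * β * Real.sqrt J.n * smoothingParameter J.lattice ((2⁻¹ : ℝ) ^ J.n)) ≤ (cU (Um J) : ℝ) * ((J.rn : ℝ) / J.rd) :=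
      mul_le_mul_of_nonneg_left hp.le hc.le
    have e : 9 / 10 * ((cU (Um J) : ℝ) * J.rn / J.rd) = 9 / 10 * ((cU (Um J) : ℝ) * ((J.rn : ℝ) / J.rd)) := by ring
    rw [e]
    nlinarith [mul_nonneg hc.le hη0, hβ, hsn]
  -- norms of the rows
  have hσ := norm_scaledRows_le hJ
  -- the key estimate of Thm. 5.9 on the integer fine grid
  have key := toReal_naturalAttempt_success_ge hB hS hli hqN O (ε := (2⁻¹ : ℝ) ^ J.n) (by positivity)
    (pow_lt_one₀ (by norm_num) (by norm_num) (by omega)) hβ hr0 hn hηs hσ (TshJ P J j α) (tgtJ J) j α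
    (fun z hz => sum_smul_fineGridVec_TshJ hJ hN0 hα hz) hside ℓ
  rw [hs_eq] at key
  refine key.trans (ENNReal.toReal_mono (PMF.toOuterMeasure_ne_top _ _) (PMF.toOuterMeasure_mono _ (Set.inter_subset_left.trans ?_)))
  -- close vectors are good answers
  rintro u ⟨huΛ, hdist⟩
  refine mem_goodAnswers_of_close hJ huΛ (hdist.trans ?_)
  have hq0 : (0 : ℝ) < P.q := by exact_mod_cast Nat.pos_of_ne_zero (NeZero.ne P.q)
  have hmax : 0 ≤ J.maxNorm := Real.sqrt_nonneg _
  -- `n √m β (c ‖S‖)/q ≤ c ‖S‖/8` and `r ≤ c rn/rd`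
  have h1 : J.n * Real.sqrt P.m * β * ((cU (Um J) : ℝ) * J.maxNorm) / P.q ≤ (cU (Um J) : ℝ) * (J.maxNorm / 8) := by
    rw [div_le_iff₀ hq0]
    have := mul_le_mul_of_nonneg_left hq8 (mul_nonneg hc.le hmax)
    nlinarith
  have h2 : r ≤ (cU (Um J) : ℝ) * J.radius := by
    rw [hr, hrad]
    have := mul_le_mul_of_nonneg_right hsle (by positivity : (0 : ℝ) ≤ β * Real.sqrt J.n / 2)
    rw [show 2 * ((cU (Um J) : ℝ) * J.rn / J.rd) / (β * Real.sqrt J.n) * (β * Real.sqrt J.n / 2) = (cU (Um J) : ℝ) * (J.rn / J.rd) by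
      field_simp] at this
    linarith [show sW * β * Real.sqrt J.n / 2 = sW * (β * Real.sqrt J.n / 2) by ring]
  nlinarith

end Instance

end DualGrid

end Literature.Algebra.EuclideanLattices

end

/-! ## Part II — the law of the solver's output on uniform coins -/

noncomputable section

open scoped Classical ENNReal

namespace Literature.Algebra.EuclideanLattices

open Module Matrix Finset GSInverse Literature.Probability.Distributions PMF MRLemma510
  Literature.Computability.Complexity Literature.Computability.Complexity.CodeFP Literature.Computability.Cryptography
  Literature.Computability.QuantumComplexity

namespace DualGrid

/-! ### Currying an independent product -/

/-- **Currying `⨂_{t < m·n} D` into `⨂_{i<m} ⨂_{l<n} D`** along `finProdFinEquiv (i, l) = l + n·i`. [folklore] -/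
theorem indepLaw_map_curry {α : Type*} (m n : ℕ) (D : PMF α) :
    (indepLaw (m * n) fun _ => D).map (fun X (i : Fin m) (l : Fin n) => X (finProdFinEquiv (i, l))) =
      indepLaw m fun _ => indepLaw n fun _ => D := by
  -- the currying map is a bijection with inverse `Y ↦ t ↦ Y (e⁻¹ t).1 (e⁻¹ t).2`
  set cur : (Fin (m * n) → α) → Fin m → Fin n → α := fun X i l => X (finProdFinEquiv (i, l)) with hcur
  set unc : (Fin m → Fin n → α) → Fin (m * n) → α := fun Y t => Y (finProdFinEquiv.symm t).1 (finProdFinEquiv.symm t).2 with hunc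
  have hcu : ∀ Y, cur (unc Y) = Y := fun Y => by
    funext i l
    show Y (finProdFinEquiv.symm (finProdFinEquiv (i, l))).1 (finProdFinEquiv.symm (finProdFinEquiv (i, l))).2 = Y i l
    rw [Equiv.symm_apply_apply]
  have huc : ∀ X, unc (cur X) = X := fun X => by
    funext t
    show X (finProdFinEquiv ((finProdFinEquiv.symm t).1, (finProdFinEquiv.symm t).2)) = X t
    rw [Prod.mk.eta, Equiv.apply_symm_apply]
  refine indepLaw_eq_of_apply _ _ fun Y => ?_
  rw [PMF.map_apply, tsum_eq_single (unc Y)]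
  · rw [if_pos (hcu Y).symm, indepLaw_apply]
    simp only [indepLaw_apply]
    rw [Fintype.prod_equiv finProdFinEquiv.symm (fun t => D (unc Y t)) (fun p => D (Y p.1 p.2)) (fun t => rfl), Fintype.prod_prod_type]
  · intro X hX
    rw [if_neg]
    intro h
    exact hX (by rw [h, huc])

/-! ### Changing the one-dimensional sampler -/

variable {n : ℕ}

/-- `Δ(gridNoiseWith D T, gridNoiseWith D' T) ≤ n · Δ(D, D')` (a local copy of
`MRGapCVPRunDOrder.tvDist_gridNoiseWith_le`, whose module is not imported here). [cite: Goldreich2001, §3.2.3] -/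
private theorem tvDist_gridNoiseWith_le' (D D' : PMF ℤ) (T : Fin n → ℤ) :
    (gridNoiseWith D T).tvDist (gridNoiseWith D' T) ≤ n * D.tvDist D' := by
  rw [gridNoiseWith, gridNoiseWith]
  refine (tvDist_map_le_holds _ _ _).trans ((tvDist_indepLaw_le n _ _).trans ?_)
  simp

/-- **`Δ(attempt with D, attempt with D') ≤ m · (n · Δ(D, D'))`**: the attempt is a Markov kernel
applied to the `m` independent noise vectors. [cite: Goldreich2001, §3.2.3 (hybrid argument) with §3.2.2 (processing)] -/
theorem tvDist_naturalAttemptWith_le {m : ℕ} (B : Matrix (Fin n) (Fin n) ℤ) (N : ℕ) (S : Matrix (Fin n) (Fin n) ℤ) {q : ℕ}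
    (D D' : PMF ℤ) (O : Matrix (Fin n) (Fin m) (ZMod q) → PMF (Fin m → ℤ)) (Tsh : Fin m → Fin n → ℤ) (ℓ : ℕ) :
    (naturalAttemptWith B N S D O Tsh ℓ).tvDist (naturalAttemptWith B N S D' O Tsh ℓ) ≤ m * (n * D.tvDist D') := by
  rw [naturalAttemptWith, naturalAttemptWith]
  refine (tvDist_bind_left_le _ _ _).trans ((tvDist_indepLaw_le m _ _).trans ?_)
  calc ∑ i, (gridNoiseWith D (Tsh i)).tvDist (gridNoiseWith D' (Tsh i)) ≤ ∑ _i : Fin m, (n : ℝ) * D.tvDist D' :=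
        Finset.sum_le_sum fun i _ => tvDist_gridNoiseWith_le' D D' (Tsh i)
    _ = m * (n * D.tvDist D') := by simp

/-! ### The random inputs of the solver read off coin blocks -/

section Pieces

variable {m : ℕ}

/-- **The samples as a family**: sample `(i, l)` is the flat sampler on chunk `l + n·i` of the block. [folklore] -/
def XfOf (PG : PGParams) (n m : ℕ) (w₁ : List Bool) : Fin m → Fin n → ℤ :=
  fun i l => PG.samplerFlat (chunk PG.coinLen w₁ (finProdFinEquiv (i, l)))

/-- **The boxes as a family**: box `(i, l)` is the value of chunk `l + n·i` of width `ℓ`. [folklore] -/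
def κfOf (n m ell : ℕ) (w₂ : List Bool) : Fin m → Fin n → ℤ :=
  fun i l => (bitsToNat (chunk ell w₂ (finProdFinEquiv (i, l))) : ℤ)

/-- Reading an entry of a window of a mapped range. [folklore] -/
theorem getD_take_drop_map_range {β : Type*} (f : ℕ → β) (d : β) {T k n l : ℕ} (hl : l < n) (hk : k + n ≤ T) :
    ((((List.range T).map f).drop k).take n).getD l d = f (k + l) := by
  rw [List.getD_eq_getElem _ _ (by simp; omega), List.getElem_take, List.getElem_drop, List.getElem_map, List.getElem_range]

/-- The machine's list of sample vectors is the `ofFn` list of `XfOf`. [folklore] -/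
theorem Xs_eq_ofFn (PG : PGParams) (n m : ℕ) (w₁ : List Bool) :
    ((List.range m).map fun i => ((samplerVecOf PG.ctx (n * m) PG.coinLen w₁).drop (i * n)).take n) =
      List.ofFn fun i => vecL (XfOf PG n m w₁ i) := by
  rw [samplerVecOf_ctx]
  refine List.ext_getElem (by simp) fun i h1 h2 => ?_
  simp only [List.getElem_map, List.getElem_range, List.getElem_ofFn]
  have hi : i < m := by simpa using h1
  have hin : i * n + n ≤ n * m := by
    calc i * n + n = (i + 1) * n := by ring
      _ ≤ m * n := Nat.mul_le_mul_right _ hi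
      _ = n * m := Nat.mul_comm _ _
  refine list_eq_of_getD (n := n) ?_ (by simp) fun l => ?_
  · simp only [List.length_take, List.length_drop, List.length_map, List.length_range]; omega
  · rw [getD_vecL, getD_take_drop_map_range _ _ l.2 hin, XfOf, finProdFinEquiv_apply_val]
    congr 1; simp only; ring

/-- The machine's list of box vectors is the `ofFn` list of `κfOf`. [folklore] -/
theorem κs_eq_ofFn (n m ell : ℕ) (w₂ : List Bool) :
    ((List.range m).map fun i => (List.range n).map fun l => (bitsToNat ((w₂.drop ((i * n + l) * ell)).take ell) : ℤ)) =
      List.ofFn fun i => vecL (κfOf n m ell w₂ i) := by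
  refine List.ext_getElem (by simp) fun i h1 h2 => ?_
  simp only [List.getElem_map, List.getElem_range, List.getElem_ofFn]
  refine list_eq_of_getD (n := n) (by simp) (by simp) fun l => ?_
  rw [getD_vecL, List.getD_eq_getElem _ _ (by simp), List.getElem_map, List.getElem_range, κfOf, chunk, finProdFinEquiv_apply_val]
  congr 3; simp only; ring

/-! ### Laws of the samples and of the boxes on uniform blocks -/

/-- **The samples on a uniform block are `m` independent vectors of `n` independent `ℓ'`-samples.**
[cite: AaronsonArkhipov2013, Thm. 1.1 (a randomised machine reads a uniform string)] -/
theorem uniformVector_map_XfOf (PG : PGParams) (n m : ℕ) {C : ℕ} (hC : PG.coinLen * (m * n) ≤ C) :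
    (uniformOfFintype (List.Vector Bool C)).map (fun v => XfOf PG n m v.toList) =
      indepLaw m fun _ => indepLaw n fun _ => PG.lawPMF := by
  have hcomp : (fun v : List.Vector Bool C => XfOf PG n m v.toList) =
      (fun X (i : Fin m) (l : Fin n) => X (finProdFinEquiv (i, l))) ∘ PGParams.samplerVec PG (m * n) hC := by
    funext v; rfl
  rw [hcomp, ← PMF.map_comp, PGParams.uniformVector_map_samplerVec_eq_indepLaw, indepLaw_map_curry]

/-- The value of a uniform `ℓ`-bit word is uniform on `[0, 2^ℓ)`, read in `ℤ`: the box coordinate law. [folklore] -/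
theorem uniformVector_map_bitsToNat_int (ell : ℕ) :
    (uniformOfFintype (List.Vector Bool ell)).map (fun w => (bitsToNat w.toList : ℤ)) =
      (uniformOfFintype (Fin (2 ^ ell))).map fun x : Fin (2 ^ ell) => ((x : ℕ) : ℤ) := by
  have hcomp : (fun w : List.Vector Bool ell => (bitsToNat w.toList : ℤ)) = (fun x : Fin (2 ^ ell) => ((x : ℕ) : ℤ)) ∘ vecNum := by
    funext w; rfl
  have h := Literature.InformationTheory.Coding.map_uniformOfFintype_of_bijective (vecNum (K := ell)) (vecNum_bijective ell)
  rw [hcomp, ← PMF.map_comp, h]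

/-- **The boxes on a uniform block are `m` independent `boxLaw n ℓ` vectors.** [folklore] -/
theorem uniformVector_map_κfOf (n m ell : ℕ) {C : ℕ} (hC : ell * (m * n) ≤ C) :
    (uniformOfFintype (List.Vector Bool C)).map (fun v => κfOf n m ell v.toList) = indepLaw m fun _ => boxLaw n ell := by
  have hcomp : (fun v : List.Vector Bool C => κfOf n m ell v.toList) =
      (fun X (i : Fin m) (l : Fin n) => X (finProdFinEquiv (i, l))) ∘
        ((fun ws : Fin (m * n) → List.Vector Bool ell => fun t => (bitsToNat (ws t).toList : ℤ)) ∘ chunks ell (m * n) hC) := by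
    funext v; rfl
  rw [hcomp, ← PMF.map_comp, ← PMF.map_comp, uniformVector_map_chunks_eq_indepLaw,
    Literature.Probability.Distributions.indepLaw_uniformOfFintype,
    uniformPi_map_eq_indepLaw (m * n) (fun w : List.Vector Bool ell => (bitsToNat w.toList : ℤ)), uniformVector_map_bitsToNat_int,
    indepLaw_map_curry]
  congr 1; funext i
  rw [boxLaw, ← uniformPi_map_eq_indepLaw n (fun x : Fin (2 ^ ell) => ((x : ℕ) : ℤ))]

/-! ### The solver with the guess fixed -/

/-- The query string of the attempt from its samples and boxes (lists). [folklore] -/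
def qsOf (P : SolParams) (n : ℕ) (U V : List (List ℤ)) (tw : List ℤ) (td rd : ℕ) (j : ℕ) (α : ℤ) (Xs κs : List (List ℤ)) : List Bool :=
  queryStr n P.m P.q ((attDataOfJ P n U V td rd α).aRowsL
    ((List.range P.m).map fun i => addL (Xs.getD i []) (TshRow P n (cOf n U) tw rd α j i)) κs)

/-- The oracle's answer from the query and the rest of the coins (coin count guessed from `lenBits` coins). [folklore] -/
def ansOf (P : SolParams) (orun : List Bool → List Bool → List Bool) (ocb : ℕ → ℕ) (qs w₃ : List Bool) : List Bool :=
  orun qs ((w₃.drop P.lenBits).take (bitsToNat (w₃.take P.lenBits) % (ocb qs.length + 1)))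

/-- **The solver with the guess `(j, α)` fixed**, reading the coins `rest` after the guess bits.
[cite: MicciancioRegev2007, Thm. 5.9 (steps 2–4 for a fixed guess)] -/
def perGuess (P : SolParams) (orun : List Bool → List Bool → List Bool) (ocb : ℕ → ℕ)
    (n : ℕ) (U V : List (List ℤ)) (tw : List ℤ) (td rn rd : ℕ) (j : ℕ) (α : ℤ) (rest : List Bool) : List Bool :=
  let PG := PGOf P n U td rn rd α
  let Xs := (List.range P.m).map fun i => ((samplerVecOf PG.ctx (n * P.m) PG.coinLen rest).drop (i * n)).take n
  let w₂ := rest.drop (n * P.m * PG.coinLen)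
  let ell := ellOf P.prec n P.m (GSInverse.invDen (TSrowsOf n U V))
  let κs := (List.range P.m).map fun i => (List.range n).map fun l => (bitsToNat ((w₂.drop ((i * n + l) * ell)).take ell) : ℤ)
  let qs := qsOf P n U V tw td rd j α Xs κs
  rawE intE (solCore P n U V tw td rd j α Xs κs (readAns P.m (ansOf P orun ocb qs (w₂.drop (n * P.m * ell)))))

/-- **The solver is the fixed-guess solver at the guess read off the first `Lg` coins.** [folklore] -/
theorem solRun_eq_perGuess (P : SolParams) (orun : List Bool → List Bool → List Bool) (ocb : ℕ → ℕ)
    (n : ℕ) (U V : List (List ℤ)) (tw : List ℤ) (td rn rd : ℕ) (w : List Bool) :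
    solRun P orun ocb n U V tw td rn rd w =
      perGuess P orun ocb n U V tw td rn rd (guessOf P w).1 (alphaZ P.βhat (guessOf P w).2) (w.drop P.Lg) := rfl

/-! ### The pieces read prefixes -/

/-- A chunk inside a prefix does not see the suffix. [folklore] -/
theorem chunk_append_of_le {K : ℕ} {a : List Bool} (b : List Bool) {t : ℕ} (h : K * (t + 1) ≤ a.length) :
    chunk K (a ++ b) t = chunk K a t := by
  have h1 : K * t ≤ a.length := le_trans (Nat.mul_le_mul_left _ (Nat.le_succ t)) h
  have h2 : K ≤ a.length - K * t := by rw [Nat.mul_succ] at h; omega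
  rw [chunk, chunk, List.drop_append_of_le_length h1, List.take_append_of_le_length (by simpa using h2)]

/-- The samples read the first `coinLen·(m·n)` coins only. [folklore] -/
theorem XfOf_append (PG : PGParams) (n m : ℕ) {a : List Bool} (b : List Bool) (ha : PG.coinLen * (m * n) ≤ a.length) :
    XfOf PG n m (a ++ b) = XfOf PG n m a := by
  funext i l
  rw [XfOf, XfOf, chunk_append_of_le b]
  exact le_trans (Nat.mul_le_mul_left _ (finProdFinEquiv (i, l)).2) ha

/-- The boxes read the first `ℓ·(m·n)` coins only. [folklore] -/
theorem κfOf_append (n m ell : ℕ) {a : List Bool} (b : List Bool) (ha : ell * (m * n) ≤ a.length) :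
    κfOf n m ell (a ++ b) = κfOf n m ell a := by
  funext i l
  rw [κfOf, κfOf, chunk_append_of_le b]
  exact le_trans (Nat.mul_le_mul_left _ (finProdFinEquiv (i, l)).2) ha

/-! ### Generic coin plumbing -/

/-- **Splitting a uniform string**: a function of a uniform string of length `C` is the compound of
its prefix of length `K` and the independent uniform suffix. [folklore] -/
theorem uniformVector_map_eq_bind_split {β : Type*} (K C : ℕ) (h : K ≤ C) (f : List.Vector Bool C → β) :
    (uniformOfFintype (List.Vector Bool C)).map f =
      (uniformOfFintype (List.Vector Bool K)).bind fun a =>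
        (uniformOfFintype (List.Vector Bool (C - K))).map fun b => f ((vecSplit K C h).symm (a, b)) := by
  have hf : f = (fun p : List.Vector Bool K × List.Vector Bool (C - K) => f ((vecSplit K C h).symm p)) ∘ vecSplit K C h := by
    funext r; simp
  conv_lhs => rw [hf, ← PMF.map_comp, uniformVector_map_vecSplit, uniformOfFintype_prod_eq_bind, PMF.map_bind]
  simp only [PMF.map_comp, Function.comp_def]

/-- The inverse split is an append. [folklore] -/
theorem vecSplit_symm_toList {K C : ℕ} (h : K ≤ C) (a : List.Vector Bool K) (b : List.Vector Bool (C - K)) :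
    ((vecSplit K C h).symm (a, b)).toList = a.toList ++ b.toList := rfl

/-- **A prefix of a uniform string is uniform.** [folklore] -/
theorem uniformVector_map_take (K C : ℕ) (h : K ≤ C) :
    (uniformOfFintype (List.Vector Bool C)).map (fun r => r.toList.take K) =
      (uniformOfFintype (List.Vector Bool K)).map List.Vector.toList := by
  rw [uniformVector_map_eq_bind_split K C h]
  have hk : ∀ (a : List.Vector Bool K) (b : List.Vector Bool (C - K)), ((vecSplit K C h).symm (a, b)).toList.take K = a.toList :=
    fun a b => by rw [vecSplit_symm_toList, List.take_append_of_le_length (by simp), List.take_of_length_le (by simp)]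
  simp only [hk]
  have hc : (fun a : List.Vector Bool K => (uniformOfFintype (List.Vector Bool (C - K))).map fun _ => a.toList) =
      PMF.pure ∘ List.Vector.toList := by
    funext a; exact PMF.map_const _ _
  rw [hc, PMF.bind_pure_comp]

/-- **Feeding a randomized algorithm from a uniform string**: running `B` on `x` with the first
`coinLen |x|` coins of a long enough uniform string has the law `B.outputPMF id x`.
[cite: AaronsonArkhipov2013, Thm. 1.1 (randomised = deterministic on a uniform string)] -/
theorem uniformVector_map_run_take (B : RandAlg (List Bool) (List Bool)) (x : List Bool) {C : ℕ} (h : B.coinLen x.length ≤ C) :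
    (uniformOfFintype (List.Vector Bool C)).map (fun r => B.run x (r.toList.take (B.coinLen x.length))) = B.outputPMF id x := by
  have hcomp : (fun r : List.Vector Bool C => B.run x (r.toList.take (B.coinLen x.length))) =
      (fun l => B.run x l) ∘ fun r : List.Vector Bool C => r.toList.take (B.coinLen x.length) := rfl
  rw [hcomp, ← PMF.map_comp, uniformVector_map_take _ _ h, PMF.map_comp, RandAlg.outputPMF]
  rfl

/-- **Guessing a bounded number from uniform bits**: for `v < M`, the value of `L` uniform bits reduced
mod `M` equals `v` with probability at least `⌊2^L/M⌋ / 2^L`. [folklore] -/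
theorem toReal_uniformVector_natMod_fiber_ge (L M : ℕ) [NeZero M] {v : ℕ} (hv : v < M) :
    (((2 ^ L / M : ℕ) : ℝ)) / 2 ^ L ≤
      ((uniformOfFintype (List.Vector Bool L)).toOuterMeasure {w | bitsToNat w.toList % M = v}).toReal := by
  have hpre : {w : List.Vector Bool L | bitsToNat w.toList % M = v} = vecNum ⁻¹' {x : Fin (2 ^ L) | (x : ℕ) % M = v} := rfl
  have hmap := Literature.InformationTheory.Coding.map_uniformOfFintype_of_bijective (vecNum (K := L)) (vecNum_bijective L)
  rw [hpre, ← PMF.toOuterMeasure_map_apply, hmap, toOuterMeasure_uniformOfFintype_apply, Fintype.card_fin,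
    ENNReal.toReal_div]
  push_cast
  refine div_le_div_of_nonneg_right ?_ (by positivity)
  have hcard : 2 ^ L / M ≤ Fintype.card {x : Fin (2 ^ L) | (x : ℕ) % M = v} := by
    rw [Fintype.card_ofFinset]
    refine (card_fiber_natMod_ge (2 ^ L) M (v : ZMod M)).trans (le_of_eq (Finset.card_bij (fun x _ => x) ?_ (fun _ _ _ _ h => h) ?_))
    · intro x hx
      simp only [Finset.mem_filter, Finset.mem_univ, true_and] at hx
      simp only [Set.mem_setOf_eq, Finset.mem_filter, Finset.mem_univ, true_and]
      have := (ZMod.natCast_eq_natCast_iff' x v M).1 hx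
      rwa [Nat.mod_eq_of_lt hv] at this
    · intro x hx
      refine ⟨x, ?_, rfl⟩
      simp only [Finset.mem_filter, Finset.mem_univ, true_and] at hx
      simp only [Finset.mem_filter, Finset.mem_univ, true_and]
      rw [ZMod.natCast_eq_natCast_iff', hx, Nat.mod_eq_of_lt hv]
  exact_mod_cast hcard

/-! ### The fixed-guess solver on a split coin string -/

/-- The output as a function of the samples, the boxes and the oracle's answer. [folklore] -/
def Gfun (P : SolParams) (n : ℕ) (U V : List (List ℤ)) (tw : List ℤ) (td rd : ℕ) (j : ℕ) (α : ℤ)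
    (X κ : Fin P.m → Fin n → ℤ) (ans : List Bool) : List Bool :=
  rawE intE (solCore P n U V tw td rd j α (List.ofFn fun i => vecL (X i)) (List.ofFn fun i => vecL (κ i)) (readAns P.m ans))

/-- The query as a function of the samples and the boxes. [folklore] -/
def qfun (P : SolParams) (n : ℕ) (U V : List (List ℤ)) (tw : List ℤ) (td rd : ℕ) (j : ℕ) (α : ℤ)
    (X κ : Fin P.m → Fin n → ℤ) : List Bool :=
  qsOf P n U V tw td rd j α (List.ofFn fun i => vecL (X i)) (List.ofFn fun i => vecL (κ i))

/-- **The fixed-guess solver on `ab ++ (lb ++ r₄)`** (`|ab| = n·m·cl + n·m·ℓ`, `|lb| = lenBits`): samples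
from the first `n·m·cl` coins of `ab`, boxes from the rest of `ab`, coin-count guess from `lb`, oracle
coins from `r₄`. [folklore] -/
theorem perGuess_append (P : SolParams) (orun : List Bool → List Bool → List Bool) (ocb : ℕ → ℕ)
    (n : ℕ) (U V : List (List ℤ)) (tw : List ℤ) (td rn rd : ℕ) (j : ℕ) (α : ℤ) {ab lb : List Bool} (r₄ : List Bool)
    (hab : ab.length = n * P.m * (PGOf P n U td rn rd α).coinLen + n * P.m * ellOf P.prec n P.m (GSInverse.invDen (TSrowsOf n U V)))
    (hlb : lb.length = P.lenBits) :
    perGuess P orun ocb n U V tw td rn rd j α (ab ++ (lb ++ r₄)) =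
      Gfun P n U V tw td rd j α (XfOf (PGOf P n U td rn rd α) n P.m ab)
        (κfOf n P.m (ellOf P.prec n P.m (GSInverse.invDen (TSrowsOf n U V))) (ab.drop (n * P.m * (PGOf P n U td rn rd α).coinLen)))
        (orun (qfun P n U V tw td rd j α (XfOf (PGOf P n U td rn rd α) n P.m ab)
            (κfOf n P.m (ellOf P.prec n P.m (GSInverse.invDen (TSrowsOf n U V))) (ab.drop (n * P.m * (PGOf P n U td rn rd α).coinLen))))
          (r₄.take (bitsToNat lb % (ocb (qfun P n U V tw td rd j α (XfOf (PGOf P n U td rn rd α) n P.m ab)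
            (κfOf n P.m (ellOf P.prec n P.m (GSInverse.invDen (TSrowsOf n U V))) (ab.drop (n * P.m * (PGOf P n U td rn rd α).coinLen)))).length + 1)))) := by
  set PG := PGOf P n U td rn rd α with hPG
  set ell := ellOf P.prec n P.m (GSInverse.invDen (TSrowsOf n U V)) with hell
  set L₁ := n * P.m * PG.coinLen with hL₁
  have hL₁le : L₁ ≤ ab.length := by rw [hab]; exact Nat.le_add_right _ _
  -- the samples
  have hX : ((List.range P.m).map fun i => ((samplerVecOf PG.ctx (n * P.m) PG.coinLen (ab ++ (lb ++ r₄))).drop (i * n)).take n) =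
      List.ofFn fun i => vecL (XfOf PG n P.m ab i) := by
    rw [Xs_eq_ofFn, XfOf_append _ _ _ _ (by rw [hab]; nlinarith [Nat.zero_le (n * P.m * ell), Nat.mul_comm n P.m])]
  -- the second block
  have hw₂ : (ab ++ (lb ++ r₄)).drop L₁ = ab.drop L₁ ++ (lb ++ r₄) := List.drop_append_of_le_length hL₁le
  have hlen₂ : (ab.drop L₁).length = n * P.m * ell := by rw [List.length_drop, hab, hL₁]; omega
  have hκ : ((List.range P.m).map fun i => (List.range n).map fun l =>
      (bitsToNat (((ab.drop L₁ ++ (lb ++ r₄)).drop ((i * n + l) * ell)).take ell) : ℤ)) =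
      List.ofFn fun i => vecL (κfOf n P.m ell (ab.drop L₁) i) := by
    rw [κs_eq_ofFn, κfOf_append _ _ _ _ (by rw [hlen₂]; nlinarith [Nat.mul_comm n P.m])]
  -- the third block
  have hw₃ : (ab.drop L₁ ++ (lb ++ r₄)).drop (n * P.m * ell) = lb ++ r₄ := by
    rw [List.drop_append_of_le_length (by rw [hlen₂]), List.drop_eq_nil_iff.2 (by rw [hlen₂]), List.nil_append]
  have hlb₁ : (lb ++ r₄).take P.lenBits = lb := by rw [← hlb]; exact List.take_left
  have hlb₂ : (lb ++ r₄).drop P.lenBits = r₄ := by rw [← hlb]; exact List.drop_left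
  simp only [perGuess]
  rw [← hPG, ← hL₁, hX, hw₂, ← hell, hκ, hw₃, Gfun, qfun, ansOf, hlb₁, hlb₂]

end Pieces

/-! ### The fixed-guess solver on a well-formed instance: identification with the natural attempt -/

section Run

open IncGDDInst

variable (P : SolParams) (J : IncGDDInst)

/-- The pseudo-Gaussian parameters of the guess `α` on the instance `J`. [folklore] -/
def PGJ (α : ℤ) : PGParams := PGOf P J.n J.U J.td J.rn J.rd α

/-- The box length of the instance. [folklore] -/
def ellJ : ℕ := ellOf P.prec J.n P.m (GSInverse.invDen (TSrowsOf J.n J.U J.V))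

/-- **The oracle kernel of a randomized `SIS` algorithm `B`**: on the query matrix, the law of the
decoded answer of `B` run on `SIS.encodeMatrix`. [cite: MicciancioRegev2007, Thm. 5.9 (the oracle call)] -/
def OJ (B : RandAlg (List Bool) (List Bool)) (A : Matrix (Fin J.n) (Fin P.m) (ZMod P.q)) : PMF (Fin P.m → ℤ) :=
  (B.outputPMF id (SIS.encodeMatrix A)).map (decodeIntVec P.m)

/-- The output code of a candidate `u' ∈ Λ'`. [folklore] -/
def OUT (u' : Fin J.n → ℤ) : List Bool := rawE intE (vecL (answerOf (Um J) u'))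

/-- The shifted noises of a guess. [folklore] -/
def KfJ (j : ℕ) (α : ℤ) (X : Fin P.m → Fin J.n → ℤ) : Fin P.m → Fin J.n → ℤ := fun i => X i + TshJ P J j α i

variable {P J}

/-- `PGJ` is `std mₚ e` with the `e` of the `Fin`-indexed analysis. [folklore] -/
theorem PGJ_eq (hJ : J.WellFormed) (α : ℤ) :
    PGJ P J α = PGParams.std P.mp (eOfJ P J.n (cU (Um J)) J.rn J.rd (NJ P J α)) := by
  rw [PGJ, PGOf, ← rowsOf_Um hJ, cOf_rowsOf (det_Um hJ)]; rfl

/-- `ellJ` is `ellOf prec n m dT`. [folklore] -/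
theorem ellJ_eq (hJ : J.WellFormed) : ellJ P J = ellOf P.prec J.n P.m (dTJ J) := by
  rw [ellJ, ← rowsOf_Um hJ, ← rowsOf_Vm hJ, TSrowsOf_rowsOf (det_Um hJ)]; rfl

/-- **The query of the machine is `SIS.encodeMatrix` of the natural attempt's query matrix.**
[cite: MicciancioRegev2007, Thm. 5.9 (step 3) with Def. 5.3] -/
theorem qfun_eq (hJ : J.WellFormed) [NeZero P.q] (j : ℕ) (α : ℤ) (X κ : Fin P.m → Fin J.n → ℤ) :
    qfun P J.n J.U J.V J.tw J.td J.rd j α X κ =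
      SIS.encodeMatrix (Amat (BU (Um J)) (NJ P J α) (scaledRows (Um J) (Vm J)) P.q (KfJ P J j α X) κ) := by
  have hq : 0 < P.q := Nat.pos_of_ne_zero (NeZero.ne P.q)
  rw [qfun, qsOf, ← rowsOf_Um hJ, ← rowsOf_Vm hJ, ← vecL_twv hJ, cOf_rowsOf (det_Um hJ), Ks_eq_ofFn P rfl,
    attDataOfJ_eq P (det_Um hJ), aRowsL_eq, queryStr_eq hq]
  rfl

/-- **The output of the machine is `OUT (uVec …)` of the natural attempt's candidate.**
[cite: MicciancioRegev2007, Thm. 5.9 (steps 2–4)] -/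
theorem Gfun_eq (hJ : J.WellFormed) (j : ℕ) (α : ℤ) (X κ : Fin P.m → Fin J.n → ℤ) (ans : List Bool) :
    Gfun P J.n J.U J.V J.tw J.td J.rd j α X κ ans =
      OUT J (uVec (BU (Um J)) (NJ P J α) (scaledRows (Um J) (Vm J)) P.q (KfJ P J j α X) κ (decodeIntVec P.m ans)) := by
  rw [Gfun, OUT, ← rowsOf_Um hJ, ← rowsOf_Vm hJ, ← vecL_twv hJ, readAns_eq_ofFn_decodeIntVec,
    show List.ofFn (decodeIntVec P.m ans) = vecL (decodeIntVec P.m ans) from rfl, solCore_eq P rfl (det_Um hJ)]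
  rfl

/-- **The natural attempt as the compound of the sample law, the box law and the oracle kernel.** [folklore] -/
theorem naturalAttemptWith_eq_bind {n m : ℕ} (B : Matrix (Fin n) (Fin n) ℤ) (N : ℕ) [NeZero N] (S : Matrix (Fin n) (Fin n) ℤ) {q : ℕ}
    (D : PMF ℤ) (O : Matrix (Fin n) (Fin m) (ZMod q) → PMF (Fin m → ℤ)) (Tsh : Fin m → Fin n → ℤ) (ℓ : ℕ) :
    naturalAttemptWith B N S D O Tsh ℓ =
      (indepLaw m fun _ => indepLaw n fun _ => D).bind fun X =>
        (indepLaw m fun _ => boxLaw n ℓ).bind fun κ =>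
          (O (Amat B N S q (fun i => X i + Tsh i) κ)).map fun z => uVec B N S q (fun i => X i + Tsh i) κ z := by
  have h : (indepLaw m fun i => gridNoiseWith D (Tsh i)) = (indepLaw m fun _ => indepLaw n fun _ => D).map fun X i => X i + Tsh i := by
    rw [indepLaw_map_pi m (fun _ => indepLaw n fun _ => D) (fun i x => x + Tsh i)]; rfl
  rw [naturalAttemptWith, h, PMF.bind_map]
  rfl

/-- **The samples and boxes read off one uniform block are independent with the product law.** [folklore] -/
theorem uniformVector_map_pair (PG : PGParams) (n m ell : ℕ) :
    (uniformOfFintype (List.Vector Bool (n * m * PG.coinLen + n * m * ell))).map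
        (fun ab => (XfOf PG n m ab.toList, κfOf n m ell (ab.toList.drop (n * m * PG.coinLen)))) =
      (indepLaw m fun _ => indepLaw n fun _ => PG.lawPMF).bind fun X =>
        (indepLaw m fun _ => boxLaw n ell).map (Prod.mk X) := by
  set L₁ := n * m * PG.coinLen with hL₁
  have hle : L₁ ≤ L₁ + n * m * ell := Nat.le_add_right _ _
  rw [uniformVector_map_eq_bind_split L₁ _ hle]
  have hpt : ∀ (a : List.Vector Bool L₁) (b : List.Vector Bool (L₁ + n * m * ell - L₁)),
      (XfOf PG n m ((vecSplit L₁ _ hle).symm (a, b)).toList, κfOf n m ell (((vecSplit L₁ _ hle).symm (a, b)).toList.drop L₁)) =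
        (XfOf PG n m a.toList, κfOf n m ell b.toList) := fun a b => by
    rw [vecSplit_symm_toList, XfOf_append _ _ _ _ (by rw [List.Vector.toList_length]; simp [hL₁]; nlinarith [Nat.mul_comm n m]),
      show (a.toList ++ b.toList).drop L₁ = b.toList from List.drop_left' a.toList_length]
  simp only [hpt]
  have hX := uniformVector_map_XfOf PG n m (C := L₁) (by rw [hL₁]; nlinarith [Nat.mul_comm n m])
  have hκ := uniformVector_map_κfOf n m ell (C := L₁ + n * m * ell - L₁) (by rw [Nat.add_sub_cancel_left]; nlinarith [Nat.mul_comm n m])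
  rw [← hX, PMF.bind_map]
  refine congrArg _ (funext fun a => ?_)
  rw [Function.comp_apply, ← hκ, PMF.map_comp]
  rfl

/-! ### The main inequality: the machine's fixed-guess run dominates `ρ ·` the natural attempt -/

/-- **The oracle step for one block of samples/boxes**: integrating the coin-count guess and the oracle
coins, the machine's output law dominates `ρ` times the law `(B.outputPMF q).map G` of the honest
oracle call, `ρ = ⌊2^{lenBits}/(c_max+1)⌋/2^{lenBits}` (the guess of `B.coinLen |q| ≤ c_max` is right with
at least that probability). [cite: MicciancioRegev2007, Thm. 5.9 (the oracle call); the coin-count guessing device of `SISFunctionSolver.lean`] -/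
theorem oracleStep_ge (P : SolParams) (B : RandAlg (List Bool) (List Bool)) (ocb : ℕ → ℕ) {cbmax : ℕ} (q : List Bool)
    (hcoin : B.coinLen q.length ≤ ocb q.length) (hcb : ocb q.length ≤ cbmax) (G : List Bool → List Bool) (E : Set (List Bool))
    {R₄ : ℕ} (hR₄ : cbmax ≤ R₄) :
    ENNReal.ofReal ((((2 ^ P.lenBits / (cbmax + 1) : ℕ) : ℝ)) / 2 ^ P.lenBits) * ((B.outputPMF id q).map G).toOuterMeasure E ≤
      ((uniformOfFintype (List.Vector Bool P.lenBits)).bind fun lb =>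
        (uniformOfFintype (List.Vector Bool R₄)).map fun r₄ =>
          G (B.run q (r₄.toList.take (bitsToNat lb.toList % (ocb q.length + 1))))).toOuterMeasure E := by
  classical
  set H : Set (List.Vector Bool P.lenBits) := {lb | bitsToNat lb.toList % (ocb q.length + 1) = B.coinLen q.length} with hH
  set g : ℝ≥0∞ := ((B.outputPMF id q).map G).toOuterMeasure E with hg
  -- on `H` the inner law is the honest oracle call
  have hin : ∀ lb ∈ H, ((uniformOfFintype (List.Vector Bool R₄)).map fun r₄ =>
      G (B.run q (r₄.toList.take (bitsToNat lb.toList % (ocb q.length + 1))))) = (B.outputPMF id q).map G := by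
    intro lb hlb
    rw [Set.mem_setOf_eq] at hlb
    rw [hlb, show (fun r₄ : List.Vector Bool R₄ => G (B.run q (r₄.toList.take (B.coinLen q.length)))) =
      G ∘ fun r₄ : List.Vector Bool R₄ => B.run q (r₄.toList.take (B.coinLen q.length)) from rfl, ← PMF.map_comp,
      uniformVector_map_run_take B q (hcoin.trans (hcb.trans hR₄))]
  -- the probability of `H`
  haveI : NeZero (ocb q.length + 1) := ⟨Nat.succ_ne_zero _⟩
  have hHge : ENNReal.ofReal ((((2 ^ P.lenBits / (cbmax + 1) : ℕ) : ℝ)) / 2 ^ P.lenBits) ≤ (uniformOfFintype (List.Vector Bool P.lenBits)).toOuterMeasure H := by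
    refine ENNReal.ofReal_le_of_le_toReal (le_trans ?_ (toReal_uniformVector_natMod_fiber_ge P.lenBits (ocb q.length + 1)
      (v := B.coinLen q.length) (by omega)))
    refine div_le_div_of_nonneg_right ?_ (by positivity)
    exact_mod_cast Nat.div_le_div_left (by omega) (Nat.succ_pos _)
  -- integrate
  rw [toOuterMeasure_bind_apply]
  calc ENNReal.ofReal ((((2 ^ P.lenBits / (cbmax + 1) : ℕ) : ℝ)) / 2 ^ P.lenBits) * g
      ≤ (uniformOfFintype (List.Vector Bool P.lenBits)).toOuterMeasure H * g := mul_le_mul_left hHge g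
    _ = ∑' lb, H.indicator (uniformOfFintype (List.Vector Bool P.lenBits)) lb * g := by
        rw [toOuterMeasure_apply, ENNReal.tsum_mul_right]
    _ ≤ _ := ENNReal.tsum_le_tsum fun lb => ?_
  by_cases hlb : lb ∈ H
  · rw [Set.indicator_of_mem hlb, hin lb hlb]
  · rw [Set.indicator_of_notMem hlb, zero_mul]; exact bot_le

variable (P J) in
/-- The block length of the samples and boxes. [folklore] -/
def LabJ (α : ℤ) : ℕ := J.n * P.m * (PGJ P J α).coinLen + J.n * P.m * ellJ P J

/-- **The main inequality**: on uniform coins of length `R ≥ Lab + lenBits + c_max`, the fixed-guess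
solver's output hits any set `E` with probability at least `ρ` times the probability that the natural
attempt (with the machine's pseudo-Gaussian one-dimensional law and the oracle kernel of `B`) produces
a candidate whose output code lies in `E`. [cite: MicciancioRegev2007, Thm. 5.9 (steps 1–4, machine form)] -/
theorem toOuterMeasure_perGuess_ge (hJ : J.WellFormed) [NeZero P.q] (B : RandAlg (List Bool) (List Bool)) (ocb : ℕ → ℕ) {cbmax : ℕ}
    (hcoin : ∀ A : Matrix (Fin J.n) (Fin P.m) (ZMod P.q), B.coinLen (SIS.encodeMatrix A).length ≤ ocb (SIS.encodeMatrix A).length)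
    (hcb : ∀ A : Matrix (Fin J.n) (Fin P.m) (ZMod P.q), ocb (SIS.encodeMatrix A).length ≤ cbmax)
    (j : Fin P.m) (α : ℤ) [NeZero (NJ P J α)] (E : Set (List Bool)) {R : ℕ} (hR : LabJ P J α + P.lenBits + cbmax ≤ R) :
    ENNReal.ofReal ((((2 ^ P.lenBits / (cbmax + 1) : ℕ) : ℝ)) / 2 ^ P.lenBits) *
        (naturalAttemptWith (BU (Um J)) (NJ P J α) (scaledRows (Um J) (Vm J)) (PGJ P J α).lawPMF (OJ P J B) (TshJ P J j α)
          (ellJ P J)).toOuterMeasure {u' | OUT J u' ∈ E} ≤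
      (uniformOfFintype (List.Vector Bool R)).toOuterMeasure
        {rest | perGuess P B.run ocb J.n J.U J.V J.tw J.td J.rn J.rd j α rest.toList ∈ E} := by
  classical
  have hLabR : LabJ P J α ≤ R := by omega
  have hlen : P.lenBits ≤ R - LabJ P J α := by omega
  have hR₄ : cbmax ≤ R - LabJ P J α - P.lenBits := by omega
  -- the pieces as functions of the first block
  set Xo : List.Vector Bool (LabJ P J α) → (Fin P.m → Fin J.n → ℤ) := fun ab => XfOf (PGJ P J α) J.n P.m ab.toList with hXo
  set κo : List.Vector Bool (LabJ P J α) → (Fin P.m → Fin J.n → ℤ) :=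
    fun ab => κfOf J.n P.m (ellJ P J) (ab.toList.drop (J.n * P.m * (PGJ P J α).coinLen)) with hκo
  set qo : (Fin P.m → Fin J.n → ℤ) → (Fin P.m → Fin J.n → ℤ) → List Bool := fun X κ => qfun P J.n J.U J.V J.tw J.td J.rd j α X κ with hqo
  set Go : (Fin P.m → Fin J.n → ℤ) → (Fin P.m → Fin J.n → ℤ) → List Bool → List Bool :=
    fun X κ ans => Gfun P J.n J.U J.V J.tw J.td J.rd j α X κ ans with hGo
  set kern : (Fin P.m → Fin J.n → ℤ) × (Fin P.m → Fin J.n → ℤ) → PMF (List Bool) :=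
    fun p => (B.outputPMF id (qo p.1 p.2)).map (Go p.1 p.2) with hkern
  -- (1) the machine's law as an iterated compound
  have h1 : (uniformOfFintype (List.Vector Bool R)).map (fun rest => perGuess P B.run ocb J.n J.U J.V J.tw J.td J.rn J.rd j α rest.toList) =
      (uniformOfFintype (List.Vector Bool (LabJ P J α))).bind fun ab =>
        (uniformOfFintype (List.Vector Bool P.lenBits)).bind fun lb =>
          (uniformOfFintype (List.Vector Bool (R - LabJ P J α - P.lenBits))).map fun r₄ =>
            Go (Xo ab) (κo ab) (B.run (qo (Xo ab) (κo ab)) (r₄.toList.take (bitsToNat lb.toList % (ocb (qo (Xo ab) (κo ab)).length + 1)))) := by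
    rw [uniformVector_map_eq_bind_split (LabJ P J α) R hLabR]
    refine congrArg _ (funext fun ab => ?_)
    rw [uniformVector_map_eq_bind_split P.lenBits (R - LabJ P J α) hlen]
    refine congrArg _ (funext fun lb => ?_)
    congr 1
    funext r₄
    rw [vecSplit_symm_toList, vecSplit_symm_toList, perGuess_append P B.run ocb J.n J.U J.V J.tw J.td J.rn J.rd j α r₄.toList ab.toList_length
      lb.toList_length]
    rfl
  -- (2) the machine side
  rw [show {rest : List.Vector Bool R | perGuess P B.run ocb J.n J.U J.V J.tw J.td J.rn J.rd j α rest.toList ∈ E} =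
      (fun rest : List.Vector Bool R => perGuess P B.run ocb J.n J.U J.V J.tw J.td J.rn J.rd j α rest.toList) ⁻¹' E from rfl,
    ← toOuterMeasure_map_apply, h1, toOuterMeasure_bind_apply]
  -- (3) the natural side as the compound of the block law and the kernel
  have h3 : (naturalAttemptWith (BU (Um J)) (NJ P J α) (scaledRows (Um J) (Vm J)) (PGJ P J α).lawPMF (OJ P J B) (TshJ P J j α)
      (ellJ P J)).toOuterMeasure {u' | OUT J u' ∈ E} =
      ∑' ab, uniformOfFintype (List.Vector Bool (LabJ P J α)) ab * (kern (Xo ab, κo ab)).toOuterMeasure E := by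
    rw [← toOuterMeasure_bind_apply, show {u' | OUT J u' ∈ E} = OUT J ⁻¹' E from rfl, ← toOuterMeasure_map_apply]
    refine congrArg (fun μ : PMF (List Bool) => μ.toOuterMeasure E) ?_
    show (naturalAttemptWith (BU (Um J)) (NJ P J α) (scaledRows (Um J) (Vm J)) (PGJ P J α).lawPMF (OJ P J B) (TshJ P J j α)
        (ellJ P J)).map (OUT J) =
      (uniformOfFintype (List.Vector Bool (J.n * P.m * (PGJ P J α).coinLen + J.n * P.m * ellJ P J))).bind
        (kern ∘ fun ab => (XfOf (PGJ P J α) J.n P.m ab.toList, κfOf J.n P.m (ellJ P J) (ab.toList.drop (J.n * P.m * (PGJ P J α).coinLen))))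
    rw [← PMF.bind_map, uniformVector_map_pair (PGJ P J α) J.n P.m (ellJ P J), PMF.bind_bind, naturalAttemptWith_eq_bind, PMF.map_bind]
    congr 1
    funext X
    rw [PMF.bind_map, PMF.map_bind]
    congr 1
    funext κ
    simp only [Function.comp_apply, hkern, hqo, hGo, OJ, PMF.map_comp]
    rw [qfun_eq hJ]
    congr 1
    funext ans
    simp only [Function.comp_apply, Gfun_eq hJ]
    rfl
  rw [h3, ← ENNReal.tsum_mul_left]
  refine ENNReal.tsum_le_tsum fun ab => ?_
  rw [← mul_assoc, mul_comm (ENNReal.ofReal _), mul_assoc]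
  refine mul_le_mul_right ?_ _
  -- (4) the oracle step for this block
  have hq : ∃ A : Matrix (Fin J.n) (Fin P.m) (ZMod P.q), qo (Xo ab) (κo ab) = SIS.encodeMatrix A := ⟨_, qfun_eq hJ j α _ _⟩
  obtain ⟨A, hA⟩ := hq
  have := oracleStep_ge P B ocb (qo (Xo ab) (κo ab)) (by rw [hA]; exact hcoin A) (by rw [hA]; exact hcb A) (Go (Xo ab) (κo ab)) E hR₄
  exact this

/-! ### The success probability of the fixed-guess solver at the good guess -/

/-- `N · s = 2^e √π`: the width realised by the pseudo-Gaussian sampler on the fine grid. [folklore] -/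
theorem NJ_mul_sOfJ (α : ℤ) [NeZero (NJ P J α)] :
    ((NJ P J α : ℕ) : ℝ) * sOfJ P J α = (2 : ℝ) ^ eOfJ P J.n (cU (Um J)) J.rn J.rd (NJ P J α) * Real.sqrt Real.pi := by
  have hN : ((NJ P J α : ℕ) : ℝ) ≠ 0 := by exact_mod_cast NeZero.ne (NJ P J α)
  rw [sOfJ, sJ]; field_simp

set_option maxHeartbeats 800000 in
/-- **MR07 Thm. 5.9 for the machine's fixed-guess solver (good guess).** Under the hypotheses of
`toReal_naturalAttempt_goodAnswers_ge`, with pseudo-Gaussian precision `mₚ ≥ 1` realised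
(`mₚ + rOf mₚ + 1 ≤ e`) and enough coins, the fixed-guess solver at the good guess outputs a good
answer with probability at least `ρ · ((δ − m·(2ε/(1+ε) + n dT/2^ℓ + n q/N))/3 − m·n·20·2^{-mₚ})`.
[cite: MicciancioRegev2007, Thm. 5.9 (proof pp. 22–24), machine form] -/
theorem toReal_perGuess_goodAnswers_ge (hJ : J.WellFormed) [NeZero P.q] (hN0 : 0 < P.N₀)
    (B : RandAlg (List Bool) (List Bool)) (ocb : ℕ → ℕ) {cbmax : ℕ}
    (hcoin : ∀ A : Matrix (Fin J.n) (Fin P.m) (ZMod P.q), B.coinLen (SIS.encodeMatrix A).length ≤ ocb (SIS.encodeMatrix A).length)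
    (hcb : ∀ A : Matrix (Fin J.n) (Fin P.m) (ZMod P.q), ocb (SIS.encodeMatrix A).length ≤ cbmax)
    {β : ℝ} (hβeq : β = (P.βnum : ℝ) / P.βden)
    (hnum : 0 < P.βnum) (hden : 0 < P.βden) (hN03 : 3 * β * Real.sqrt J.n ≤ P.N₀) (hqN0 : P.q ≤ P.N₀)
    (hq8 : 8 * J.n * Real.sqrt P.m * β ≤ P.q)
    (hside : 1 / (2 * Real.pi) + (2⁻¹ : ℝ) ^ J.n / (1 - (2⁻¹ : ℝ) ^ J.n) + ((2⁻¹ : ℝ) ^ J.n / (1 - (2⁻¹ : ℝ) ^ J.n)) ^ 2 * P.m ≤ 1 / 6)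
    (hprom : J.Promise (3 * β * Real.sqrt J.n)) (j : Fin P.m) {α : ℤ} (hα : α ≠ 0) [NeZero (NJ P J α)]
    (hmp : 1 ≤ P.mp) (hE : P.mp + PGParams.rOf P.mp + 1 ≤ eOfJ P J.n (cU (Um J)) J.rn J.rd (NJ P J α))
    {R : ℕ} (hR : LabJ P J α + P.lenBits + cbmax ≤ R) :
    ((((2 ^ P.lenBits / (cbmax + 1) : ℕ) : ℝ)) / 2 ^ P.lenBits) *
        ((1 / 3 : ℝ) *
            ((((PMF.uniformOfFintype (Matrix (Fin J.n) (Fin P.m) (ZMod P.q))).bind fun A => (OJ P J B A).map (Prod.mk A)).toOuterMeasure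
                {az | az.1.mulVec (fun i => (az.2 i : ZMod P.q)) = 0 ∧ ∑ i, (az.2 i : ℝ) ^ 2 ≤ β ^ 2 ∧ az.2 j = α}).toReal -
              P.m * (2 * (2⁻¹ : ℝ) ^ J.n / (1 + (2⁻¹ : ℝ) ^ J.n) + J.n * ((((dTJ J).toNat : ℕ) : ℝ) / 2 ^ ellJ P J) +
                J.n * ((P.q : ℝ) / NJ P J α))) -
          P.m * (J.n * (20 * ((2 : ℝ) ^ P.mp)⁻¹))) ≤
      ((uniformOfFintype (List.Vector Bool R)).toOuterMeasure
        {rest | perGuess P B.run ocb J.n J.U J.V J.tw J.td J.rn J.rd j α rest.toList ∈ J.goodAnswers}).toReal := by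
  set ρ : ℝ := (((2 ^ P.lenBits / (cbmax + 1) : ℕ) : ℝ)) / 2 ^ P.lenBits with hρ
  have hρ0 : 0 ≤ ρ := by positivity
  -- the plumbing inequality, in `ℝ`
  have hmain := toOuterMeasure_perGuess_ge (P := P) hJ B ocb hcoin hcb j α J.goodAnswers hR
  set X := (naturalAttemptWith (BU (Um J)) (NJ P J α) (scaledRows (Um J) (Vm J)) (PGJ P J α).lawPMF (OJ P J B) (TshJ P J j α)
    (ellJ P J)).toOuterMeasure {u' | OUT J u' ∈ J.goodAnswers} with hX
  have hXtop : X ≠ ⊤ := PMF.toOuterMeasure_ne_top _ _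
  have hreal : ρ * X.toReal ≤ ((uniformOfFintype (List.Vector Bool R)).toOuterMeasure
      {rest | perGuess P B.run ocb J.n J.U J.V J.tw J.td J.rn J.rd j α rest.toList ∈ J.goodAnswers}).toReal := by
    have := ENNReal.toReal_mono (PMF.toOuterMeasure_ne_top _ _) hmain
    rwa [ENNReal.toReal_mul, ENNReal.toReal_ofReal hρ0] at this
  refine le_trans (mul_le_mul_of_nonneg_left ?_ hρ0) hreal
  -- the natural attempt with the machine's sampler versus the exact discrete Gaussian
  have hTV : (naturalAttemptWith (BU (Um J)) (NJ P J α) (scaledRows (Um J) (Vm J)) (PGJ P J α).lawPMF (OJ P J B) (TshJ P J j α)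
      (ellJ P J)).tvDist (naturalAttempt (BU (Um J)) (NJ P J α) (scaledRows (Um J) (Vm J)) (OJ P J B) (sOfJ P J α) (TshJ P J j α) (ellJ P J)) ≤
      P.m * (J.n * (20 * ((2 : ℝ) ^ P.mp)⁻¹)) := by
    rw [naturalAttempt, NJ_mul_sOfJ]
    refine (tvDist_naturalAttemptWith_le _ _ _ _ _ _ _ _).trans ?_
    rw [PGJ_eq hJ]
    have h := PGParams.tvDist_lawPMF_std_discreteGaussianInt_le P.mp (eOfJ P J.n (cU (Um J)) J.rn J.rd (NJ P J α)) hmp hE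
    gcongr
  have hdiff := abs_toReal_toOuterMeasure_sub_le_tvDist
    (naturalAttempt (BU (Um J)) (NJ P J α) (scaledRows (Um J) (Vm J)) (OJ P J B) (sOfJ P J α) (TshJ P J j α) (ellJ P J))
    (naturalAttemptWith (BU (Um J)) (NJ P J α) (scaledRows (Um J) (Vm J)) (PGJ P J α).lawPMF (OJ P J B) (TshJ P J j α) (ellJ P J))
    {u' | OUT J u' ∈ J.goodAnswers}
  rw [tvDist_comm] at hdiff
  have hS4 := toReal_naturalAttempt_goodAnswers_ge (P := P) hJ hN0 (OJ P J B) hβeq hnum hden hN03 hqN0 hq8 hside hprom j hα (ellJ P J)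
  rw [abs_le] at hdiff
  have : (naturalAttempt (BU (Um J)) (NJ P J α) (scaledRows (Um J) (Vm J)) (OJ P J B) (sOfJ P J α) (TshJ P J j α) (ellJ P J)).toOuterMeasure
      {u' | rawE intE (vecL (answerOf (Um J) u')) ∈ J.goodAnswers} =
      (naturalAttempt (BU (Um J)) (NJ P J α) (scaledRows (Um J) (Vm J)) (OJ P J B) (sOfJ P J α) (TshJ P J j α) (ellJ P J)).toOuterMeasure
      {u' | OUT J u' ∈ J.goodAnswers} := rfl
  rw [this] at hS4
  linarith

/-! ### The realised pseudo-Gaussian precision: `e ≥ k + 1` once `N ≥ 2^{k+1} β √n rd` -/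

/-- **`k + 1 ≤ e`** when `2^{k+1} β√n·rd ≤ N` (`c rn ≥ 1`): then `4^{k+1} ≤ X`. [folklore] -/
theorem succ_le_eOfJ (hnum : 0 < P.βnum) (hden : 0 < P.βden) {n : ℕ} (hn : 0 < n) {c : ℤ} (hc : 1 ≤ c) {rn rd N : ℕ}
    (hrn : 1 ≤ rn) (hrd : 0 < rd) {k : ℕ} (hN : (2 : ℝ) ^ (k + 1) * ((P.βnum : ℝ) / P.βden) * Real.sqrt n * rd ≤ N) :
    k + 1 ≤ eOfJ P n c rn rd N := by
  have hX : 4 ^ (k + 1) ≤ XOfJ P n c rn rd N := by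
    rw [XOfJ, Nat.le_div_iff_mul_le (by positivity)]
    have hsn : (0 : ℝ) < Real.sqrt n := Real.sqrt_pos.2 (by exact_mod_cast hn)
    have h1 : ((2 : ℝ) ^ (k + 1) * ((P.βnum : ℝ) / P.βden) * Real.sqrt n * rd) ^ 2 ≤ (N : ℝ) ^ 2 := pow_le_pow_left₀ (by positivity) hN 2
    rw [mul_pow, mul_pow, mul_pow, div_pow, Real.sq_sqrt (by positivity), ← pow_mul,
      show (k + 1) * 2 = 2 * (k + 1) by ring, pow_mul, show (2 : ℝ) ^ 2 = 4 by norm_num] at h1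
    have hd : (0 : ℝ) < P.βden ^ 2 := by positivity
    have h2 : (4 : ℝ) ^ (k + 1) * P.βnum ^ 2 * n * rd ^ 2 ≤ N ^ 2 * P.βden ^ 2 := by
      have := mul_le_mul_of_nonneg_right h1 hd.le
      rwa [show (4 : ℝ) ^ (k + 1) * ((P.βnum : ℝ) ^ 2 / P.βden ^ 2) * n * rd ^ 2 * P.βden ^ 2 = 4 ^ (k + 1) * P.βnum ^ 2 * n * rd ^ 2 by
        field_simp] at this
    have hc1 : (1 : ℝ) ≤ c := by exact_mod_cast hc
    have hrn1 : (1 : ℝ) ≤ rn := by exact_mod_cast hrn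
    have h3 : (1 : ℝ) ≤ (c : ℝ) ^ 2 * rn ^ 2 := one_le_mul_of_one_le_of_one_le (one_le_pow₀ hc1) (one_le_pow₀ hrn1)
    have h4 : (4 : ℝ) ^ (k + 1) * (63 * P.βnum ^ 2 * n * rd ^ 2) ≤ 80 * c.natAbs ^ 2 * rn ^ 2 * N ^ 2 * P.βden ^ 2 := by
      rw [show ((c.natAbs : ℕ) : ℝ) ^ 2 = (c : ℝ) ^ 2 by rw [Nat.cast_natAbs, Int.cast_abs, sq_abs]]
      have h5 : (0 : ℝ) ≤ N ^ 2 * P.βden ^ 2 := by positivity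
      nlinarith [mul_le_mul_of_nonneg_left h2 (by positivity : (0:ℝ) ≤ c ^ 2 * rn ^ 2), pow_pos (show (0:ℝ) < 4 by norm_num) (k + 1)]
    exact_mod_cast h4
  rw [eOfJ]
  have hlog : 2 * (k + 1) ≤ Nat.log 2 (XOfJ P n c rn rd N) :=
    Nat.le_log_of_pow_le (by norm_num) (by rw [pow_mul]; exact hX)
  omega

/-! ### The solver: summing over the guess -/

/-- **Reading the good guess**: on a guess block in the fibre of `v = j·(2β̂) + a`, the solver is the
fixed-guess solver at `(j, alphaOf β̂ a)`. [folklore] -/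
theorem solRun_append_of_fiber (P : SolParams) (orun : List Bool → List Bool → List Bool) (ocb : ℕ → ℕ)
    (n : ℕ) (U V : List (List ℤ)) (tw : List ℤ) (td rn rd : ℕ) {g : List Bool} (hg : g.length = P.Lg)
    (j : Fin P.m) (aidx : Fin (2 * P.βhat)) (hv : bitsToNat g % (P.m * (2 * P.βhat)) = (j : ℕ) * (2 * P.βhat) + (aidx : ℕ))
    (rest : List Bool) :
    solRun P orun ocb n U V tw td rn rd (g ++ rest) = perGuess P orun ocb n U V tw td rn rd j (alphaOf P.βhat aidx) rest := by
  have h2 : 0 < 2 * P.βhat := by have := aidx.2; omega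
  have hq : ((j : ℕ) * (2 * P.βhat) + (aidx : ℕ)) / (2 * P.βhat) = j := by
    rw [Nat.add_comm, Nat.add_mul_div_right _ _ h2, Nat.div_eq_of_lt aidx.2, zero_add]
  have hr : ((j : ℕ) * (2 * P.βhat) + (aidx : ℕ)) % (2 * P.βhat) = aidx := by
    rw [Nat.add_comm, Nat.add_mul_mod_self_right, Nat.mod_eq_of_lt aidx.2]
  rw [solRun_eq_perGuess, guessOf, List.take_left' hg, hv, hq, hr, List.drop_left' hg, alphaZ_eq]

set_option maxHeartbeats 800000 in
/-- **MR07 Thm. 5.9 for the machine's solver.** For a well-formed instance with the promise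
`3β√n·η_{2⁻ⁿ}(L(U)) < r` and parameters as displayed, on uniform coins the solver `solRun` outputs a
good answer with probability at least
`ρ_g · ρ · ((δ/(2βm) − m·(2ε/(1+ε) + n dT/2^ℓ + n q/N₀))/3 − m n·20·2^{-mₚ})`, where
`δ = SIS.successProb B n m q β`, `ρ_g = ⌊2^{Lg}/(2β̂m)⌋/2^{Lg}` (the guess is right) and
`ρ = ⌊2^{lenBits}/(c_max+1)⌋/2^{lenBits}` (the oracle's coin count is guessed right).
[cite: MicciancioRegev2007, Thm. 5.9 (pp. 22–24), machine form] -/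
theorem toReal_solRun_goodAnswers_ge (hJ : J.WellFormed) [NeZero P.q] (hN0 : 0 < P.N₀)
    (B : RandAlg (List Bool) (List Bool)) (ocb : ℕ → ℕ) {cbmax : ℕ}
    (hcoin : ∀ A : Matrix (Fin J.n) (Fin P.m) (ZMod P.q), B.coinLen (SIS.encodeMatrix A).length ≤ ocb (SIS.encodeMatrix A).length)
    (hcb : ∀ A : Matrix (Fin J.n) (Fin P.m) (ZMod P.q), ocb (SIS.encodeMatrix A).length ≤ cbmax)
    {β : ℝ} (hβeq : β = (P.βnum : ℝ) / P.βden) (hβ1 : 1 ≤ β) (hβhat : ⌊β⌋₊ ≤ P.βhat)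
    (hnum : 0 < P.βnum) (hden : 0 < P.βden)
    (hN0E : (2 : ℝ) ^ (P.mp + PGParams.rOf P.mp + 2) * β * Real.sqrt J.n ≤ P.N₀) (hqN0 : P.q ≤ P.N₀)
    (hq8 : 8 * J.n * Real.sqrt P.m * β ≤ P.q)
    (hside : 1 / (2 * Real.pi) + (2⁻¹ : ℝ) ^ J.n / (1 - (2⁻¹ : ℝ) ^ J.n) + ((2⁻¹ : ℝ) ^ J.n / (1 - (2⁻¹ : ℝ) ^ J.n)) ^ 2 * P.m ≤ 1 / 6)
    (hprom : J.Promise (3 * β * Real.sqrt J.n)) (hm : 0 < P.m) (hmp : 1 ≤ P.mp)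
    {R : ℕ} (hR : ∀ α : ℤ, α ≠ 0 → |α| ≤ P.βhat → LabJ P J α + P.lenBits + cbmax ≤ R) :
    ((((2 ^ P.Lg / (P.m * (2 * P.βhat)) : ℕ) : ℝ)) / 2 ^ P.Lg) *
        (((((2 ^ P.lenBits / (cbmax + 1) : ℕ) : ℝ)) / 2 ^ P.lenBits) *
          ((1 / 3 : ℝ) *
              (SIS.successProb B J.n P.m P.q β / (2 * β * P.m) -
                P.m * (2 * (2⁻¹ : ℝ) ^ J.n / (1 + (2⁻¹ : ℝ) ^ J.n) + J.n * ((((dTJ J).toNat : ℕ) : ℝ) / 2 ^ ellJ P J) +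
                  J.n * ((P.q : ℝ) / P.N₀))) -
            P.m * (J.n * (20 * ((2 : ℝ) ^ P.mp)⁻¹)))) ≤
      ((uniformOfFintype (List.Vector Bool (P.Lg + R))).toOuterMeasure
        {w | solRun P B.run ocb J.n J.U J.V J.tw J.td J.rn J.rd w.toList ∈ J.goodAnswers}).toReal := by
  classical
  have hn : 1 ≤ J.n := hJ.one_le_n
  have hβ : 0 < β := by linarith
  have hsn : (0 : ℝ) < Real.sqrt J.n := Real.sqrt_pos.2 (by exact_mod_cast hn)
  -- (1) the good guess
  obtain ⟨j, a, ha0, hale, hguess⟩ :=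
    MicciancioRegev2007.exists_guess_kernel (n := J.n) P.q (OJ P J B) hβ1 hm
  have haβ : |a| ≤ (P.βhat : ℤ) := hale.trans (by exact_mod_cast hβhat)
  haveI : NeZero (NJ P J a) := neZero_NJ hJ hN0 ha0
  obtain ⟨aidx, haidx⟩ := exists_alphaOf_eq ha0 haβ
  -- (2) the hypotheses of the fixed-guess bound at `a`
  have hpow3 : (3 : ℝ) ≤ (2 : ℝ) ^ (P.mp + PGParams.rOf P.mp + 2) :=
    le_trans (by norm_num) (pow_le_pow_right₀ (by norm_num : (1 : ℝ) ≤ 2) (show 2 ≤ P.mp + PGParams.rOf P.mp + 2 by omega))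
  have hN03 : 3 * β * Real.sqrt J.n ≤ P.N₀ := le_trans (by nlinarith [mul_pos hβ hsn]) hN0E
  have hE : P.mp + PGParams.rOf P.mp + 1 ≤ eOfJ P J.n (cU (Um J)) J.rn J.rd (NJ P J a) := by
    -- `rn ≥ 1` from the promise, `c ≥ 1`
    have hη0 := smoothingParameter_nonneg J.lattice ((2⁻¹ : ℝ) ^ J.n)
    have hrn : 1 ≤ J.rn := by
      have h : (0 : ℝ) < J.radius := lt_of_le_of_lt (by positivity) hprom
      have hrd : (0 : ℝ) < J.rd := by exact_mod_cast hJ.rd_pos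
      have : (0 : ℝ) < J.rn := by
        by_contra h'
        push Not at h'
        have := div_nonpos_of_nonpos_of_nonneg h' hrd.le
        exact absurd h (not_lt.2 this)
      exact_mod_cast this
    refine succ_le_eOfJ (P := P) hnum hden (by omega) (cU_pos (det_Um hJ)) hrn hJ.rd_pos (k := P.mp + PGParams.rOf P.mp) ?_
    rw [← hβeq]
    -- `2^{k+1} β √n rd ≤ N₀ rd ≤ N`
    have hNge : (P.N₀ : ℝ) * J.rd ≤ NJ P J a := by
      rw [NJ, NOf]; push_cast
      have h1 : (1 : ℝ) ≤ J.td := by exact_mod_cast hJ.td_pos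
      have h2 : (1 : ℝ) ≤ (a.natAbs : ℝ) := by exact_mod_cast Int.natAbs_pos.2 ha0
      have h3 : (0 : ℝ) ≤ P.N₀ := by positivity
      have h4 : (0 : ℝ) ≤ J.rd := by positivity
      nlinarith [mul_le_mul (le_refl (P.N₀ : ℝ)) (one_le_mul_of_one_le_of_one_le h1 h2) zero_le_one h3]
    have hrd0 : (0 : ℝ) ≤ J.rd := by positivity
    have h5 : (2 : ℝ) ^ (P.mp + PGParams.rOf P.mp + 1) ≤ 2 ^ (P.mp + PGParams.rOf P.mp + 2) := pow_le_pow_right₀ (by norm_num) (by omega)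
    calc (2 : ℝ) ^ (P.mp + PGParams.rOf P.mp + 1) * β * Real.sqrt J.n * J.rd ≤ 2 ^ (P.mp + PGParams.rOf P.mp + 2) * β * Real.sqrt J.n * J.rd := by
          gcongr
      _ ≤ P.N₀ * J.rd := mul_le_mul_of_nonneg_right hN0E hrd0
      _ ≤ _ := hNge
  have hR' : LabJ P J a + P.lenBits + cbmax ≤ P.Lg + R - P.Lg := by have := hR a ha0 haβ; omega
  have hper := toReal_perGuess_goodAnswers_ge (P := P) hJ hN0 B ocb hcoin hcb hβeq hnum hden hN03 hqN0 hq8 hside hprom j ha0 hmp hE hR'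
  -- (3) the guess fibre
  set M := P.m * (2 * P.βhat) with hM
  have hβhat1 : 1 ≤ P.βhat := le_trans (Nat.le_floor (by exact_mod_cast hβ1)) hβhat
  haveI : NeZero M := ⟨by rw [hM]; exact Nat.mul_ne_zero hm.ne' (by omega)⟩
  set v : ℕ := (j : ℕ) * (2 * P.βhat) + (aidx : ℕ) with hv
  have hvM : v < M := by
    rw [hv, hM]
    calc (j : ℕ) * (2 * P.βhat) + aidx < (j : ℕ) * (2 * P.βhat) + 2 * P.βhat := by have := aidx.2; omega
      _ = ((j : ℕ) + 1) * (2 * P.βhat) := by ring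
      _ ≤ P.m * (2 * P.βhat) := Nat.mul_le_mul_right _ j.2
  set Fib : Set (List.Vector Bool P.Lg) := {g | bitsToNat g.toList % M = v} with hFib
  have hFib := toReal_uniformVector_natMod_fiber_ge P.Lg M (v := v) hvM
  -- (4) the machine's law split at the guess block
  set Y := (uniformOfFintype (List.Vector Bool (P.Lg + R - P.Lg))).toOuterMeasure
    {rest | perGuess P B.run ocb J.n J.U J.V J.tw J.td J.rn J.rd j a rest.toList ∈ J.goodAnswers} with hY
  have hcore : (uniformOfFintype (List.Vector Bool P.Lg)).toOuterMeasure Fib * Y ≤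
      (uniformOfFintype (List.Vector Bool (P.Lg + R))).toOuterMeasure
        {w | solRun P B.run ocb J.n J.U J.V J.tw J.td J.rn J.rd w.toList ∈ J.goodAnswers} := by
    rw [show {w : List.Vector Bool (P.Lg + R) | solRun P B.run ocb J.n J.U J.V J.tw J.td J.rn J.rd w.toList ∈ J.goodAnswers} =
        (fun w : List.Vector Bool (P.Lg + R) => solRun P B.run ocb J.n J.U J.V J.tw J.td J.rn J.rd w.toList) ⁻¹' J.goodAnswers from rfl,
      ← toOuterMeasure_map_apply, uniformVector_map_eq_bind_split P.Lg (P.Lg + R) (Nat.le_add_right _ _), toOuterMeasure_bind_apply,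
      toOuterMeasure_apply, ← ENNReal.tsum_mul_right]
    refine ENNReal.tsum_le_tsum fun g => ?_
    by_cases hg : g ∈ Fib
    · rw [Set.indicator_of_mem hg]
      refine mul_le_mul_right (le_of_eq ?_) _
      rw [hY, toOuterMeasure_map_apply]
      congr 1
      ext rest
      simp only [Set.mem_preimage, Set.mem_setOf_eq, vecSplit_symm_toList]
      rw [solRun_append_of_fiber P B.run ocb J.n J.U J.V J.tw J.td J.rn J.rd g.toList_length j aidx hg rest.toList, haidx]
    · rw [Set.indicator_of_notMem hg, zero_mul]; exact bot_le
  -- (5) to `ℝ`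
  have hreal := ENNReal.toReal_mono (PMF.toOuterMeasure_ne_top _ _) hcore
  rw [ENNReal.toReal_mul] at hreal
  refine le_trans ?_ hreal
  have hY0 : 0 ≤ Y.toReal := ENNReal.toReal_nonneg
  have hρg0 : (0 : ℝ) ≤ (((2 ^ P.Lg / (P.m * (2 * P.βhat)) : ℕ) : ℝ)) / 2 ^ P.Lg := by positivity
  refine le_trans (mul_le_mul_of_nonneg_left ?_ hρg0) (mul_le_mul_of_nonneg_right hFib hY0)
  refine le_trans (mul_le_mul_of_nonneg_left ?_ (by positivity)) hper
  -- (6) monotonicity in the guess's quantities: `δ/(2βm) ≤ δ_{j,a}`, `q/N ≤ q/N₀`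
  have hδ : SIS.successProb B J.n P.m P.q β / (2 * β * P.m) ≤
      (((PMF.uniformOfFintype (Matrix (Fin J.n) (Fin P.m) (ZMod P.q))).bind fun A => (OJ P J B A).map (Prod.mk A)).toOuterMeasure
        {az | az.1.mulVec (fun i => (az.2 i : ZMod P.q)) = 0 ∧ ∑ i, (az.2 i : ℝ) ^ 2 ≤ β ^ 2 ∧ az.2 j = a}).toReal := by
    rw [SIS.successProb_eq_toReal_bind]
    refine hguess.trans (ENNReal.toReal_mono (PMF.toOuterMeasure_ne_top _ _) (PMF.toOuterMeasure_mono _ ?_))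
    intro az haz
    have h1 : SIS.IsSolution az.1 β az.2 ∧ az.2 j = a := haz.1
    exact SIS.mulVec_eq_zero_and_of_isSolution h1.1 h1.2
  have hNq : (P.q : ℝ) / NJ P J a ≤ P.q / P.N₀ := by
    have hNge : (P.N₀ : ℝ) ≤ NJ P J a := by
      rw [NJ, NOf]; push_cast
      have h1 : (1 : ℝ) ≤ J.td := by exact_mod_cast hJ.td_pos
      have h2 : (1 : ℝ) ≤ (a.natAbs : ℝ) := by exact_mod_cast Int.natAbs_pos.2 ha0
      have h4 : (1 : ℝ) ≤ J.rd := by exact_mod_cast hJ.rd_pos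
      have h3 : (0 : ℝ) ≤ P.N₀ := by positivity
      calc (P.N₀ : ℝ) = P.N₀ * 1 * 1 * 1 := by ring
        _ ≤ P.N₀ * J.td * a.natAbs * J.rd := by gcongr
    exact div_le_div_of_nonneg_left (by positivity) (by exact_mod_cast hN0) hNge
  have hm0 : (0 : ℝ) ≤ P.m := by positivity
  have hn0 : (0 : ℝ) ≤ J.n := by positivity
  nlinarith [mul_le_mul_of_nonneg_left (mul_le_mul_of_nonneg_left hNq hn0) hm0]

end Run

end DualGrid

end Literature.Algebra.EuclideanLattices

end
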